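import Summits.BirchSwinnertonDyer.BirchSwinnertonDyer.Theses.PrintX10b
import Summits.BirchSwinnertonDyer.BirchSwinnertonDyer.Theorems.PrintX10bHowardContainmentAnyClassNumberX10bThm413Hyp
import Summits.BirchSwinnertonDyer.BirchSwinnertonDyer.Theorems.PrintX10bHowardContainmentLightFrameX10bEnvelope
import Literature.NumberTheory.EllipticCurves.CastellaGrossiSkinner2025.HeegnerKolyvaginBoundAnyClassNumberProofs
import Literature.NumberTheory.EllipticCurves.HeegnerCharIdealEnvelopeProofs
import Literature.NumberTheory.EllipticCurves.HeegnerCharIdealEnvelopePowTransferProofs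
import Literature.NumberTheory.EllipticCurves.IwasawaAlgebraPromotionProofs
import Literature.NumberTheory.EllipticCurves.IwasawaAlgebraSpecializationIndexProofs
import Summits.BirchSwinnertonDyer.BirchSwinnertonDyer.Theorems.HeegnerMuPartStabilizedOfSpecializedIndex
import Summits.BirchSwinnertonDyer.BirchSwinnertonDyer.Theorems.PrintX10bHowardContainmentLightFrameX10bOfMuStabilized
import Summits.BirchSwinnertonDyer.BirchSwinnertonDyer.Theorems.PrintX10bSplitClosersStabilized
import Summits.BirchSwinnertonDyer.BirchSwinnertonDyer.Theorems.PrintX9HowardContainmentLightFramePinnedOfPrintSharpOfMuStabilizedGeneric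
import Summits.BirchSwinnertonDyer.BirchSwinnertonDyer.Theorems.PrintX9MuPartStabilizedWeakLetters
import Summits.BirchSwinnertonDyer.BirchSwinnertonDyer.Theorems.PrintX9MuPartStabilizedOfSpecWitnesses
import Summits.BirchSwinnertonDyer.BirchSwinnertonDyer.Theorems.PrintX10bHowardContainmentLightFrameX10bOfMuCoherentPair
import HarnessLib

/-!
# Line `specialise-first-mu-x10b` (ideator bsd-idea-16, lens = decomp, skeleton v11 / g5) on the A-side DECIDING crux
# stmt-BirchSwinnertonDyer-27275 `PrintX10b.HowardContainmentLightFrameX10bPinnedOfPrint` (route-BirchSwinnertonDyer-PrintX10b rev 37)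

v11 (g5, 2026-08-28 ~13:0xZ) — THE LEVEL QUANTIFIER IS ∃-INFINITE (§14, all PROVED): the μ-readout needs the specialised
inequality only along SOME infinite set of levels `m` (two-sided asymptotics `#(N/q_m N) ≍ p^(m μ(N))`), so the D1 constructor may
choose its levels: `HasSpecWitnessesAlong` (∃ c, infinitely many m) replaces `HasSpecWitnesses` (∃ c m₀, ∀ m ≥ m₀);
`le_of_frequently_pow_mul_le`, `muInvariant_le_two_mul_of_frequently_card_le`, `lengthAt_le_two_mul_of_frequently_card_le`,
`lengthAt_torsion_le_two_mul_of_hasSpecWitnessesAlong`, the weakened L∃ shell `Stmt.specWitnessesCoherentPairAlong` (a SECOND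
admissible D1 target: implied by the stub, implies the installed letter `MuPartStabilizedCoherentPair` and the crux BY NAME).

v10 (g5, 2026-08-28 ~12:5xZ) — BY NAME. Within the hour of v9 the cell landed v9's §10–§11 in `Theorems/` (x9-p1-w2 g4:
`PrintX9MuPartSpecWitnessDefs.lean` p632362 — `HeegnerMuPartStabilized.SpecWitness`, `HasSpecWitnesses`, the three shells
`SpecWitnessesFrameFree` / `SpecWitnessesCoherentPair` / `SpecWitnessesPrincipal`; `PrintX9MuPartStabilizedOfSpecWitnesses.lean` p633080 —
`lengthAt_torsion_le_two_mul_of_hasSpecWitnesses`, `muPartStabilizedCoherentPair_of_specWitnessesCoherentPair`, …), plan g10 ruled THE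
CUT v2 (shared μ-item := the L∃ letter `MuPartStabilizedCoherentPair`), and x10b-p2 LEAD g4 landed the row-10 closer from L∃
(`PrintX10bHowardContainmentLightFrameX10bOfMuCoherentPair.lean` p631887). v10 DELETES this file's duplicates of those (v9 §10–§12) and
takes THE ONE STUB to be the TREE shell `HeegnerMuPartStabilized.SpecWitnessesCoherentPair` itself (§10), composing the crux BY NAME
through p633080 ∘ p631887 (§11–§12): a D1 seat's proof of the tree shell closes this line with no adapter. §13 (the typed one-sided
`∀ C` residual) is unchanged. Sorries: 1.

v9 (g5, 2026-08-28 ~12:1xZ) — THE POINTWISE CUT AND THE ROAD-NATIVE LETTER. After trib-w-tld g9's FINDING MU-LETTER-∀C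
(the shared letter `MuPartStabilizedOfPrint` quantifies over Galois-INCOHERENT stabilised data `C`; every consumer instantiates
the engine's coherent `C₀`; Howard's `q_m` road is principal-native), the weak letters `MuPartStabilizedPrincipal` (LP) /
`MuPartStabilizedCoherentPair` (L∃) LANDED (p630902, `Theorems/PrintX9MuPartStabilizedWeakLetters.lean`) and x9-p1 LEAD / ref g6
endorsing L∃: §10 separates the ALGEBRA of K1 from its QUANTIFIER SHELL — `HasSpecWitnesses p S X L` is a predicate on ONE
triple `(𝔖, 𝒳, L)` and `lengthAt_torsion_le_two_mul_of_hasSpecWitnesses` the one pointwise theorem; §11 writes the three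
letters' witness forms as shells over it (∀C = §8 `Stmt.specWitnessesFrameFree`; L∃ = `Stmt.specWitnessesCoherentPair`, now
THE ONE STUB of this file; LP = `Stmt.specWitnessesPrincipal`) with the kernel certificates `shell → letter` and `∀C-shell →
L∃-shell`; §12 PROVES the row-10 closer `MuPartStabilizedCoherentPair → HowardContainmentLightFrameX10bPinnedOfPrint` (the
twin of x9-p1 LEAD's X9 closer; x10b-p2 LEAD may re-home it to `Theorems/`) and composes the crux BY NAME from the new stub;
§13 types the exact residual of the `∀ C` letter over L∃/LP in μ-currency (ONE-SIDED domination of class modules). K1 (§1,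
the framed `∀ C` cardinality bound) is no longer a stub: it stays a statement, hypothesis of the §3–§4/§7 certificates.

HONEST FRAMING. A SKELETON published as a crux WORKFILE only (`ledger crux write stmt-BirchSwinnertonDyer-23729
Lines/specialise_first_mu_x10b.lean`); NOT registered (W-79: the crux has a seated LEAD, x10b-p2, whose line of
record — `torsion_depth_x10b_pinned_rev35.lean` since 10:52Z, which ADOPTED this line's K1μ cut as its one stub — stays registered). `sorry` ONLY inside the ONE stub
`stub_specWitnessesCoherentPair` (§10, v10: the TREE shell `HeegnerMuPartStabilized.SpecWitnessesCoherentPair`; v9: this file's copy of it; until v8 `stub_kolyvaginBoundAtEisensteinPrimes` = K1) — load-bearing, OPEN research: the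
m-uniform specialised Kolyvagin-system witnesses at Howard's primes `q_m = T^m + p`, any class number, AT THE ROAD'S OWN coherent pair. Nothing is closed; no summit statement is proved by this
seat; BSD is not proved by any of this.

v6 vs v5 (same day): the ALGEBRAIC HALF of the cut ("A": specialised-index asymptotics `#(N/q_m N) ≍ p^{m μ(N)}` and the
μ-transfer `uniform specialised index inequality ⇒ μ(N) ≤ 2 μ(N')`) LANDED in the tree while v5 was being written —
`Literature/…/IwasawaAlgebraSpecializationCountProofs.lean` (x10b-p1 LEAD, p624765), `…IndexComparisonProofs.lean`
(x10b-p1-w2, p623777), `…IndexProofs.lean` (x10b-p1 LEAD, p625052: `IwasawaAlgebra.exists_card_quotSMulTop_qm_bounds`,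
`IwasawaAlgebra.lengthAt_le_two_mul_of_card_quotSMulTop_qm_le`). v6 therefore DROPS stub A and states K1 in the tree's
CARDINALITY currency (`Nat.card (N ⧸ q_m N)`, `q_m` spelled `PowerSeries.X ^ m + PowerSeries.C (p : ℤ_[p])`, no new
definitions), so that K1 ⟹ K1μ is ONE application of the landed theorem. Sorries: 2 → 1.
v7 (same day) = v6 + §6, the WITNESS FORM of K1: an interface `SpecWitness` (D1/D2-shaped abstract data at one
Eisenstein prime `q`: control maps `f : 𝔖 → H`, `h : 𝒳/q𝒳 → Xq` with CARDINALITY-bounded coker/ker, the specialised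
class `κ₁`, and the error-free DVR bound `#Xq_tors ≤ #(H/Λκ₁)²`) plus PROVED bookkeeping L0 (Tor-vanishing
`𝒳_tors/q ↪ 𝒳/q`), L1 (torsion transport along `h`), L2 (index transport along `f`), giving
`kolyvaginBound_of_specWitnesses : Stmt.specWitnesses → K1` (PROVED). Sorries still 1.

WHAT THIS FILE CERTIFIES (kernel-checked, modulo the one stub).
1. `HowardContainmentLightFrameX10bPinnedOfPrint_of_muInequalityStabilized` — the LEAD's rev-27 composition with
   its one open stub `Stmt.muPartSharp` (μ-inequality in the TREE-FAMILY currency `μ(X_tors) ≤ 2·μ(𝔖/ℋ_F)`, over ALL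
   families `F` with `F.Dt = Dt`) REPLACED by the μ-inequality in the STABILISED currency `Stmt.muInequalityStabilized`:
   `length_(p)(X_tors) ≤ 2 · length_(p)(𝔖/Λκ_∞(C))` for CGLS's `d(k)`-shifted stabilised datum `C` — the currency in
   which CGLS Thm. 4.1.1 (`hNV`), CGS Thm. 6.5.2 (`hCGS`) and the landed coherent-pair engine
   `X10.envelopeModulesSharp_of_towerSharp` (the SHARP inclusion `ℋ_F ≤ Λκ_∞(C)`, `e = 0`) all live: promote with
   x10b-p1's p613811 at `Q := 𝔖/Λκ_∞(C)`, transfer ideals at `e = 0` afterwards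
   (`heegnerCharIdeal_le_stabilizedHeegnerCharIdeal_of_le`). No μ-comparison `ℋ_F` vs `Λκ_∞(C)` (v4's K3) is needed;
   the A-side residual at `3 ∣ h_K` is ONE statement, class-number-free and pin-free: K1μ.
2. `muInequalityStabilized_of_kolyvaginBound` — K1 ⟹ K1μ by the tree's μ-transfer
   (`IwasawaAlgebra.lengthAt_le_two_mul_of_card_quotSMulTop_qm_le`), and the converse
   `kolyvaginBound_of_muInequalityStabilized` (by `IwasawaAlgebra.exists_card_quotSMulTop_qm_bounds`): given the landed
   asymptotics the two currencies are EQUIVALENT — the cut is METHODOLOGICAL (K1 is the OUTPUT SHAPE of a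
   Kolyvagin-system argument run over the DVRs `Λ/(q_m) ≅ ℤ_p[π]`, `π^m = −p`, where MR04/Howard-type bounds with
   explicit error terms exist), recorded so the costume check is mechanical.
3. `HowardContainmentLightFrameX10bPinnedOfPrint_of_stubs : HowardContainmentLightFrameX10bPinnedOfPrint` — the crux BY
   NAME from s_cop (PROVED, the LEAD's MZ26 stub verbatim) and the one stub K1 (audit: sorries = 1, in `stub_*`).
4. §6 (v7), PROVED: `kolyvaginBound_of_specWitnesses : Stmt.specWitnesses → Stmt.kolyvaginBoundAtEisensteinPrimes` —
   K1 follows, by module algebra only, from level-wise D1/D2-shaped witnesses (`SpecWitness`) for `m ≫ 0` with control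
   constant `p^c` uniform in `m`; the interface records the g4 design constraint (errors bounded in CARDINALITY, i.e. in
   `S_m`-length — an error merely annihilated by `p^c` has `S_m`-length `c·m` and would survive `÷ m`; hence S2 must be an
   ERROR-FREE DVR bound, MZ26 Thm. 2.40-type, and CGLS/BCGS-type `E_α` bounds cannot feed K1).
5. §5, PROVED rung for K1's supplement S1 (Eisenstein-tame control, `m`-uniform): `exists_one_add_X_pow_sub_one_eq` —
   `(1+T)^{p^t} − 1 = ε·T^{p^t} + q_m·G` with `ε ∈ Λ^×` for `p^t ≤ m` — and its module forms: modulo `q_m` the twist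
   error `γ^{p^t} − 1` IS (a unit times) `T^{p^t}`, the same for every `m`.
6. §7–§8 (v7), PROVED: the x10b-p2 LEAD's rev-35 stub letter (`Stmt.muInequalityStabilizedLead`, copied verbatim; `Iff.rfl`
   with the landed `PrintX10bSharpMuStabilized.Stmt.muInequalityStabilized`) follows from K1 / K1μ / the witnesses; the
   crux also through the LANDED closer (`crux_of_kolyvaginBound_via_landed`); the FRAME-FREE forms
   `Stmt.kolyvaginBoundFrameFree` (= the landed `hKS` letter of `muPartStabilizedOfPrint_of_card_quotSMulTop_qm_le`,
   verbatim) and `Stmt.specWitnessesFrameFree` give the cell's shared μ-letter `HeegnerMuPartStabilized.MuPartStabilizedOfPrint`.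
7. §9 (v8), PROVED: through the closers landed 11:21Z (`PrintX10bSplitStabilized.howardContainmentLightFrameX10bPinnedOfPrint_of_common`,
   `PrintX9SharpMuStabilized.howardContainmentLightFramePinnedOfPrintSharp_of_muPartStabilizedOfPrint`) the frame-free witness
   form closes BY NAME this route's crux stmt-27275 AND route PrintX9's crux `HowardContainmentLightFramePinnedOfPrintSharp`:
   one construction (D1), two cruxes, zero further glue.

The genuinely intermediate waypoints of K1 — S1 (control at `q_m`, MR04 Prop. 5.3.14-type, error bounded in `m`) and
S2 (MZ26 Thm. 2.40's hypotheses at `T_{q_m}`, scalar `1+3ℤ₃ ⊆ ρ(G_{K_∞})`) — need vocabulary the tree lacks (Selmer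
structures / Kolyvagin systems over `Λ/q_m`; definition requests D1/D2 of the line card) and are recorded there;
§6 fixes the SHAPE in which they must be delivered (`SpecWitness`), not their Galois-cohomological definition.

References: B. Howard, Compositio Math. 140 (2004), §2.2–2.3, Thm. 2.2.10 (the primes `(T^m + p)`), §3.3; B. Mazur,
K. Rubin, Mem. AMS 799 (2004), §5.3 (Prop. 5.3.14); F. Castella, G. Grossi, J. Lee, C. Skinner, Invent. Math. 227
(2022), Thm. 4.1.1, 4.1.3; F. Castella, G. Grossi, C. Skinner (2025), Thm. 6.5.2; Mastella–Zerman (2026) Thm. 2.40,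
Cor. 4.6; L. Washington, GTM 83, §13.2.
-/

set_option linter.dupNamespace false
set_option autoImplicit false

noncomputable section

open scoped Classical Pointwise
open Literature Literature.NumberTheory.EllipticCurves WeierstrassCurve
  Literature.NumberTheory.EllipticCurves.ModularForms
open Literature.NumberTheory.EllipticCurves.Rank1Residual (ClassX10 Surj)

namespace Summit.BirchSwinnertonDyer.BirchSwinnertonDyer.Cruxes.HowardContainmentLightFrameX10bPinnedOfPrint.SpecialiseFirstMu

open Summit.BirchSwinnertonDyer.BirchSwinnertonDyer.Theses.PrintX10b
  (MastellaZermanHowardDivisibility CGLSHeegnerClassNonvanishing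
    CGSHowardDivisibilityPLocalized AnticyclotomicTowerSharp HowardContainmentLightFrameX10bPinned
    HowardContainmentLightFrameX10bPinnedOfPrint)

/-! ## §1 Statements (`q_m = T^m + p` is spelled `PowerSeries.X ^ m + PowerSeries.C (p : ℤ_[p])`, as in the tree) -/

/-- s_cop (verbatim from the LEAD's rev-27 skeleton): the `3 ∤ h_K` regime, tied (MZ26 Cor. 4.6 by name). -/
def Stmt.coprimeTied : Prop :=
  MastellaZermanHowardDivisibility →
    ∀ (W : WeierstrassCurve ℚ) [W.IsElliptic] [W.IsGloballyMinimal] (p : ℕ) [Fact p.Prime]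
      [NeZero (W.conductorNorm ℤ)] (K : Type) [Field K] [NumberField K],
      ClassX10 W p → ¬ Surj W 3 → ¬ W.HasCM →
      IsImaginaryQuadratic K → Odd (NumberField.discr K) → NumberField.discr K ≠ -3 →
      SatisfiesHeegnerHypothesis (W.conductorNorm ℤ) K → SatisfiesHeegnerHypothesis p K →
      (W.baseChange K).HasIrreducibleModPGaloisRep p →
      ∀ (κ : ZpExtension K p), κ.IsAnticyclotomic → ∀ (γ : Field.absoluteGaloisGroup K),
      κ.IsTopGenerator γ →
      ∀ (Dt : ModularParametrizationData W (W.conductorNorm ℤ))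
        (H : HeegnerDatum (W.conductorNorm ℤ) (NumberField.discr K)) (ιC : K →+* ℂ)
        (jbar : AlgebraicClosure K →+* ℂ),
      ¬ (p : ℤ) ∣ Dt.c → (W.baseChange K).mordellWeilRank = 1 →
      Finite (AddCommGroup.primaryComponent (W.baseChange K).sha p) →
      ¬ p ∣ NumberField.classNumber K →
      ∃ (D : (W.baseChange K).LambdaAdicSelmerData κ γ)
        (F : HeegnerFamily (W.conductorNorm ℤ) W K κ jbar) (X : (W.baseChange K).SelmerDualData κ γ),
        F.Dt = Dt ∧ heegnerCharIdeal D F ^ 2 ≤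
          Module.charIdeal (IwasawaAlgebra p) (Submodule.torsion (IwasawaAlgebra p) X.X)

/-- **K1μ — the μ-INEQUALITY IN THE STABILISED CURRENCY** (the ONE open atom of the A-side at `3 ∣ h_K` after this
file's re-cut): on a light X10b Heegner frame, for EVERY `jbar`, EVERY `Λ`-adic Selmer datum `D`, EVERY CGLS
stabilised Heegner datum `C` and EVERY Selmer dual datum `X` with `𝔖`, `𝒳` finitely generated and `𝔖/Λκ_∞(C)`
torsion: `length_(p)(X_tors) ≤ 2 · length_(p)(𝔖/Λκ_∞(C))`, i.e. `μ(X_tors) ≤ 2·μ(𝔖/Λκ_∞(C))`. Class-number-free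
and pin-free (no `Dt`, no `h_K`, no rank/Ш binder). Implied by Perrin-Riou's Heegner-point main conjecture; at
`3 ∤ h_K` a consequence of MZ26 Cor. 4.6; at `3 ∣ h_K` BEYOND CITABLE PRINT (REF-118).
[cite: Howard2004HeegnerKolyvagin, Thm. B (c) and Thm. 2.2.10] [cite: CastellaGrossiLeeSkinner2022, Thm. 4.1.3 (ii), Rem. 4.1.4]
[cite: PerrinRiou1987BSMF, Conj. B] -/
def Stmt.muInequalityStabilized : Prop :=
  ∀ (W : WeierstrassCurve ℚ) [W.IsElliptic] [W.IsGloballyMinimal] (p : ℕ) [Fact p.Prime]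
    [NeZero (W.conductorNorm ℤ)] (K : Type) [Field K] [NumberField K],
    ClassX10 W p → ¬ Surj W 3 → ¬ W.HasCM →
    IsImaginaryQuadratic K → Odd (NumberField.discr K) → NumberField.discr K ≠ -3 →
    SatisfiesHeegnerHypothesis (W.conductorNorm ℤ) K → SatisfiesHeegnerHypothesis p K →
    (W.baseChange K).HasIrreducibleModPGaloisRep p →
    ∀ (κ : ZpExtension K p), κ.IsAnticyclotomic → ∀ (γ : Field.absoluteGaloisGroup K),
    κ.IsTopGenerator γ →
    ∀ (jbar : AlgebraicClosure K →+* ℂ) (D : (W.baseChange K).LambdaAdicSelmerData κ γ)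
      (C : CastellaGrossiLeeSkinner2022.StabilizedHeegnerData (W.conductorNorm ℤ) W K κ jbar)
      (X : (W.baseChange K).SelmerDualData κ γ),
    Module.Finite (IwasawaAlgebra p) D.S → Module.Finite (IwasawaAlgebra p) X.X →
    Module.IsTorsion (IwasawaAlgebra p) (D.S ⧸ CastellaGrossiLeeSkinner2022.stabilizedHeegnerModule D C) →
    ∀ 𝔭 : PrimeSpectrum (IwasawaAlgebra p), 𝔭.asIdeal = Ideal.span {(p : IwasawaAlgebra p)} →
      Module.lengthAt (IwasawaAlgebra p) (Submodule.torsion (IwasawaAlgebra p) X.X) 𝔭 ≤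
        2 * Module.lengthAt (IwasawaAlgebra p)
          (D.S ⧸ CastellaGrossiLeeSkinner2022.stabilizedHeegnerModule D C) 𝔭

/-- **K1 (crux of the line, rank 2, load-bearing, the ONLY stub) — the Kolyvagin bound AT THE EISENSTEIN PRIMES
`q_m = T^m + p`, uniform in `m ≫ 0`, in the STABILISED currency and in the tree's CARDINALITY spelling**: on a light X10b
frame, for every stabilised datum `C` with `𝔖/Λκ_∞(C)` torsion and every Selmer dual `𝒳`,
`#(𝒳_tors ⧸ q_m 𝒳_tors) ≤ p^c · #((𝔖/Λκ_∞(C)) ⧸ q_m)²` for all `m ≥ m₀`, with `c, m₀` independent of `m`. This is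
the OUTPUT SHAPE of Howard's argument (proof of Thm. 2.2.10, «taking 𝔮 = T^m + p») run on CGLS's stabilised Λ-adic
Kolyvagin system (any `h_K`) over the DVRs `Λ/(q_m)`: S1 = control at `q_m` (MR04 Prop. 5.3.14-type, error bounded in
`m`; algebraic kernel §5), S2 = DVR Kolyvagin bound with `m`-UNIFORM error (MZ26 Thm. 2.40's hypotheses at `T_{q_m}`).
Why it might fail: the `m`-uniformity of the error at `p ∣ h_K` is exactly what print does not give (CGLS's `E_α`
grows with `rank_{ℤ_p} Λ/q_m = m`, whence only `(p^m)·I(Λκ_∞)² ⊆ char`); a growing error `c(m) → ∞` makes K1 vacuous.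
[cite: Howard2004HeegnerKolyvagin, Thm. 2.2.10, §2.3] [cite: MazurRubin2004KolyvaginSystems, Prop. 5.3.14, Thm. 5.3.10]
[cite: CastellaGrossiLeeSkinner2022, §3.3–§4.1] -/
def Stmt.kolyvaginBoundAtEisensteinPrimes : Prop :=
  ∀ (W : WeierstrassCurve ℚ) [W.IsElliptic] [W.IsGloballyMinimal] (p : ℕ) [Fact p.Prime]
    [NeZero (W.conductorNorm ℤ)] (K : Type) [Field K] [NumberField K],
    ClassX10 W p → ¬ Surj W 3 → ¬ W.HasCM →
    IsImaginaryQuadratic K → Odd (NumberField.discr K) → NumberField.discr K ≠ -3 →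
    SatisfiesHeegnerHypothesis (W.conductorNorm ℤ) K → SatisfiesHeegnerHypothesis p K →
    (W.baseChange K).HasIrreducibleModPGaloisRep p →
    ∀ (κ : ZpExtension K p), κ.IsAnticyclotomic → ∀ (γ : Field.absoluteGaloisGroup K),
    κ.IsTopGenerator γ →
    ∀ (jbar : AlgebraicClosure K →+* ℂ) (D : (W.baseChange K).LambdaAdicSelmerData κ γ)
      (C : CastellaGrossiLeeSkinner2022.StabilizedHeegnerData (W.conductorNorm ℤ) W K κ jbar)
      (X : (W.baseChange K).SelmerDualData κ γ),
    Module.Finite (IwasawaAlgebra p) D.S → Module.Finite (IwasawaAlgebra p) X.X →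
    Module.IsTorsion (IwasawaAlgebra p) (D.S ⧸ CastellaGrossiLeeSkinner2022.stabilizedHeegnerModule D C) →
    ∃ c m₀ : ℕ, ∀ m : ℕ, m₀ ≤ m →
      Nat.card (↥(Submodule.torsion (IwasawaAlgebra p) X.X) ⧸
        (Ideal.span {(PowerSeries.X ^ m + PowerSeries.C (p : ℤ_[p]) : IwasawaAlgebra p)} • ⊤ :
          Submodule (IwasawaAlgebra p) ↥(Submodule.torsion (IwasawaAlgebra p) X.X))) ≤
      p ^ c * Nat.card ((D.S ⧸ CastellaGrossiLeeSkinner2022.stabilizedHeegnerModule D C) ⧸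
        (Ideal.span {(PowerSeries.X ^ m + PowerSeries.C (p : ℤ_[p]) : IwasawaAlgebra p)} • ⊤ :
          Submodule (IwasawaAlgebra p) (D.S ⧸ CastellaGrossiLeeSkinner2022.stabilizedHeegnerModule D C))) ^ 2

/-! ## §2 (v9) K1 is NO LONGER the stub

Until v8 the ONE sorry was `stub_kolyvaginBoundAtEisensteinPrimes : Stmt.kolyvaginBoundAtEisensteinPrimes` (K1, the framed
`∀ C` cardinality bound). v9 re-letters the stub ROAD-NATIVELY (§11 `stub_specWitnessesCoherentPair`, the L∃ shell): K1 stays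
a STATEMENT and every certificate below that consumed the stub now takes K1 as a hypothesis. -/

/-! ## §3 Proved glue: K1 ⟹ K1μ by the tree's μ-transfer, and the converse (the cut is a change of currency) -/

/-- **K1 ⟹ K1μ** — one application of `IwasawaAlgebra.lengthAt_le_two_mul_of_card_quotSMulTop_qm_le`
(x10b-p1 LEAD, p625052). [cite: Howard2004HeegnerKolyvagin, proof of Thm. 2.2.10] [cite: Washington1997, §13.2] -/
theorem muInequalityStabilized_of_kolyvaginBound (hK1 : Stmt.kolyvaginBoundAtEisensteinPrimes) :
    Stmt.muInequalityStabilized := by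
  intro W _ _ p _ _ K _ _ hX hns hcm hK hodd h3 hHN hHp hirr κ hκ γ hγ jbar D C X hfinS hfinX htorC 𝔭 h𝔭
  haveI := hfinS
  haveI := hfinX
  haveI : IsNoetherian (IwasawaAlgebra p) X.X := isNoetherian_of_isNoetherianRing_of_finite _ _
  haveI : Module.Finite (IwasawaAlgebra p) (Submodule.torsion (IwasawaAlgebra p) X.X) := inferInstance
  haveI : Module.Finite (IwasawaAlgebra p) (D.S ⧸ CastellaGrossiLeeSkinner2022.stabilizedHeegnerModule D C) :=
    inferInstance
  exact IwasawaAlgebra.lengthAt_le_two_mul_of_card_quotSMulTop_qm_le p _ _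
    (Submodule.torsion_isTorsion (R := IwasawaAlgebra p) (M := X.X)) htorC
    (hK1 W p K hX hns hcm hK hodd h3 hHN hHp hirr κ hκ γ hγ jbar D C X hfinS hfinX htorC) 𝔭 h𝔭

/-- **K1μ ⟹ K1** (converse: by the landed asymptotics `IwasawaAlgebra.exists_card_quotSMulTop_qm_bounds` the two
currencies are equivalent — recorded so the costume check is mechanical, not rhetorical).
[cite: Washington1997, §13.2] [cite: Howard2004HeegnerKolyvagin, proof of Thm. 2.2.10] -/
theorem kolyvaginBound_of_muInequalityStabilized (hμC : Stmt.muInequalityStabilized) :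
    Stmt.kolyvaginBoundAtEisensteinPrimes := by
  intro W _ _ p _ _ K _ _ hX hns hcm hK hodd h3 hHN hHp hirr κ hκ γ hγ jbar D C X hfinS hfinX htorC
  haveI := hfinS
  haveI := hfinX
  haveI : IsNoetherian (IwasawaAlgebra p) X.X := isNoetherian_of_isNoetherianRing_of_finite _ _
  haveI : Module.Finite (IwasawaAlgebra p) (Submodule.torsion (IwasawaAlgebra p) X.X) := inferInstance
  haveI : Module.Finite (IwasawaAlgebra p) (D.S ⧸ CastellaGrossiLeeSkinner2022.stabilizedHeegnerModule D C) :=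
    inferInstance
  have hp : p.Prime := Fact.out
  let 𝔭 : PrimeSpectrum (IwasawaAlgebra p) :=
    ⟨Ideal.span {(p : IwasawaAlgebra p)},
      (Ideal.span_singleton_prime IwasawaAlgebra.prime_natCast.ne_zero).mpr IwasawaAlgebra.prime_natCast⟩
  have h𝔭 : 𝔭.asIdeal = Ideal.span {(p : IwasawaAlgebra p)} := rfl
  have h𝔭' : 𝔭.asIdeal = IwasawaAlgebra.augIdealP p := by rw [h𝔭, IwasawaAlgebra.span_natCast_eq_augIdealP]
  have hN : Module.IsTorsion (IwasawaAlgebra p) ↥(Submodule.torsion (IwasawaAlgebra p) X.X) :=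
    Submodule.torsion_isTorsion (R := IwasawaAlgebra p) (M := X.X)
  have hμ := hμC W p K hX hns hcm hK hodd h3 hHN hHp hirr κ hκ γ hγ jbar D C X hfinS hfinX htorC 𝔭 h𝔭
  have hN1 := lengthAt_ne_top_of_isTorsion p (↥(Submodule.torsion (IwasawaAlgebra p) X.X)) hN 𝔭 h𝔭'
  have hN2 := lengthAt_ne_top_of_isTorsion p
    (D.S ⧸ CastellaGrossiLeeSkinner2022.stabilizedHeegnerModule D C) htorC 𝔭 h𝔭'
  have key : muInvariant p ↥(Submodule.torsion (IwasawaAlgebra p) X.X) ≤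
      2 * muInvariant p (D.S ⧸ CastellaGrossiLeeSkinner2022.stabilizedHeegnerModule D C) := by
    rw [muInvariant_eq_toNat_lengthAt p (↥(Submodule.torsion (IwasawaAlgebra p) X.X)) 𝔭 h𝔭',
      muInvariant_eq_toNat_lengthAt p (D.S ⧸ CastellaGrossiLeeSkinner2022.stabilizedHeegnerModule D C) 𝔭 h𝔭']
    rw [← ENat.coe_toNat hN1, ← ENat.coe_toNat hN2] at hμ
    exact_mod_cast hμ
  obtain ⟨B, m₁, -, h1⟩ :=
    IwasawaAlgebra.exists_card_quotSMulTop_qm_bounds p (↥(Submodule.torsion (IwasawaAlgebra p) X.X)) hN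
  obtain ⟨B', m₂, -, h2⟩ := IwasawaAlgebra.exists_card_quotSMulTop_qm_bounds p
    (D.S ⧸ CastellaGrossiLeeSkinner2022.stabilizedHeegnerModule D C) htorC
  refine ⟨B * B' ^ 2, max m₁ m₂, fun m hm ↦ ?_⟩
  obtain ⟨-, -, hup⟩ := h1 m (le_trans (le_max_left _ _) hm)
  obtain ⟨-, hlow, -⟩ := h2 m (le_trans (le_max_right _ _) hm)
  have hC : B * B' ^ 2 ≤ p ^ (B * B' ^ 2) := (Nat.lt_pow_self hp.one_lt).le
  calc _ ≤ B * p ^ (m * muInvariant p ↥(Submodule.torsion (IwasawaAlgebra p) X.X)) := hup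
    _ ≤ B * p ^ (m * (2 * muInvariant p (D.S ⧸ CastellaGrossiLeeSkinner2022.stabilizedHeegnerModule D C))) :=
        Nat.mul_le_mul_left _ (Nat.pow_le_pow_right hp.pos (Nat.mul_le_mul_left m key))
    _ = B * (p ^ (m * muInvariant p (D.S ⧸ CastellaGrossiLeeSkinner2022.stabilizedHeegnerModule D C))) ^ 2 := by
        ring
    _ ≤ B * (B' * Nat.card ((D.S ⧸ CastellaGrossiLeeSkinner2022.stabilizedHeegnerModule D C) ⧸
          (Ideal.span {(PowerSeries.X ^ m + PowerSeries.C (p : ℤ_[p]) : IwasawaAlgebra p)} • ⊤ :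
            Submodule (IwasawaAlgebra p) (D.S ⧸ CastellaGrossiLeeSkinner2022.stabilizedHeegnerModule D C)))) ^ 2 := by
        gcongr
    _ = (B * B' ^ 2) * Nat.card ((D.S ⧸ CastellaGrossiLeeSkinner2022.stabilizedHeegnerModule D C) ⧸
          (Ideal.span {(PowerSeries.X ^ m + PowerSeries.C (p : ℤ_[p]) : IwasawaAlgebra p)} • ⊤ :
            Submodule (IwasawaAlgebra p) (D.S ⧸ CastellaGrossiLeeSkinner2022.stabilizedHeegnerModule D C))) ^ 2 := by
        ring
    _ ≤ _ := Nat.mul_le_mul_right _ hC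

/-! ## §4 Composition (sorry-free): the crux from s_cop and K1μ, in the STABILISED currency throughout -/

/-- `d_K` odd excludes `d_K = -4`. [folklore] -/
theorem discr_ne_neg_four_of_odd {K : Type} [Field K] [NumberField K] (hodd : Odd (NumberField.discr K)) :
    NumberField.discr K ≠ -4 := by
  rintro h; rw [h] at hodd; exact absurd hodd (by decide)

/-- **stub s_cop — PROVED (verbatim from the LEAD's rev-27 skeleton; MZ26 Cor 4.6 by name at `p = 3`)**, via
`X10.heegnerContainmentPinned_of_cor46_of_not_surj` (p607508). [cite: MastellaZerman2026, Cor. 4.6 (arXiv:2505.08710)] -/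
theorem stub_coprimeTied : Stmt.coprimeTied := by
  intro hMZ W _ _ p _ _ K _ _ hX hns hcm hK hodd h3 hHN hHp _ κ hκ γ hγ Dt H _ jbar _ _ _ hhK
  have h46 : MastellaZerman2026.cor46_howardDivisibility_of_scalarImage.{0} := hMZ
  obtain ⟨D, F, X, hFD, -, hle⟩ :=
    Summit.BirchSwinnertonDyer.BirchSwinnertonDyer.Rank1Residual.X10.heegnerContainmentPinned_of_cor46_of_not_surj
      h46 hX hns hcm hK h3 (discr_ne_neg_four_of_odd hodd) hHN hHp hhK κ hκ γ hγ Dt H jbar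
  exact ⟨D, F, X, hFD, hle⟩

/-- Local ALIAS of the crux decl. -/
def Goal : Prop := HowardContainmentLightFrameX10bPinnedOfPrint

/-- **Composition in the stabilised currency.** Fix the frame, `jbar := IsAlgClosed.lift` along `ιC`;
`3 ∤ h_K` ↦ `s_cop hMZ`. `3 ∣ h_K` ↦ `D`, `X` exist; the landed engine `X10.envelopeModulesSharp_of_towerSharp`
(from `hTw♯`) gives a COHERENT pair `(C, F)` on `Dt` with `ℋ_F ≤ Λκ_∞(C)` (SHARP, `e = 0`) and `g•Λκ_∞(C) ≤ ℋ_F`,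
`g ≠ 0`; thm411 (`hNV`) at `(D, C)` ⇒ `𝔖` torsion-free, `𝔖/Λκ_C` torsion; thm652 (`hCGS`) at `(D, C, X)` ⇒
finiteness and `(p^m)·I(Λκ_C)² ⊆ char(X_tors)`; **K1μ** at `(D, C, X)` + the sharp promotion p613811 at
`Q := 𝔖/Λκ_C` ⇒ `I(Λκ_C)² ⊆ char(X_tors)`; reverse inclusion ⇒ `𝔖/ℋ_F` torsion; the `e = 0` ideal transfer
`I(ℋ_F) ⊆ I(Λκ_C)` ⇒ `I(ℋ_F)² ⊆ char(X_tors)`. No μ-comparison between `ℋ_F` and `Λκ_C` is ever needed.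
[cite: CastellaGrossiLeeSkinner2022, Thm. 4.1.1, Thm. 4.1.3, Rem. 4.1.4] [cite: Howard2004HeegnerKolyvagin, Thm. B] -/
theorem HowardContainmentLightFrameX10bPinnedOfPrint_of_muInequalityStabilized
    (s_cop : Stmt.coprimeTied) (hμC : Stmt.muInequalityStabilized) : Goal := by
  unfold Goal HowardContainmentLightFrameX10bPinnedOfPrint
  intro hMZ hNV hCGS hTw W _ _ p _ _ K _ _ hX hns hcm hK hodd h3 hHN hHp hirr κ hκ γ hγ Dt H ιC hc hrk hfin
  letI : Algebra K ℂ := ιC.toAlgebra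
  let jbar : AlgebraicClosure K →+* ℂ :=
    (IsAlgClosed.lift (R := K) (M := ℂ) (S := AlgebraicClosure K)).toRingHom
  by_cases hhK : p ∣ NumberField.classNumber K
  · obtain ⟨D⟩ := LambdaAdicSelmerDataExists.nonempty_lambdaAdicSelmerData (W.baseChange K) p κ hγ
    obtain ⟨X⟩ := (W.baseChange K).nonempty_selmerDualData_holds κ γ hγ
    have hp : p.Prime := Fact.out
    have hp_odd : Odd p := hp.odd_of_ne_two hX.ne_two
    -- the landed coherent-pair engine: `(C, F)` on `Dt` with the SHARP forward inclusion and the reverse one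
    obtain ⟨C, F, -, hFDt, -, -, hfwd, g, hg, hrev⟩ :=
      Summit.BirchSwinnertonDyer.BirchSwinnertonDyer.Rank1Residual.X10.envelopeModulesSharp_of_towerSharp
        hX hK hodd h3 hHN hHp hκ hγ Dt H jbar (fun k ↦ hTw K p hp_odd hK κ hκ jbar k) D
    have hyp := Summit.BirchSwinnertonDyer.BirchSwinnertonDyer.Rank1Residual.X10.thm413Hypotheses_of_classX10
      hX hK h3 hHN hHp hodd hκ hγ
    -- CGLS Thm. 4.1.1 + Cornut–Vatsal BY NAME at `(D, C)`
    have h411 : CastellaGrossiLeeSkinner2022.thm411_torsionFree_heegnerClass_ne_bot_quotient_isTorsion.{0} := hNV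
    obtain ⟨hfree, -, htorC⟩ := h411 (W.conductorNorm ℤ) W K p κ γ jbar hyp D C
    haveI := hfree
    -- CGS Thm. 6.5.2 BY NAME at `(D, C, X)`
    have h652 : CastellaGrossiSkinner2025.thm652_stabilized_rankOne_charIdeal_torsion_dvd_pLocalized.{0} := hCGS
    obtain ⟨⟨hfinS, -⟩, hfinX, -⟩ := h652 (W.conductorNorm ℤ) W K p κ γ jbar hyp D C X
    haveI := hfinS
    haveI := hfinX
    obtain ⟨m, hm⟩ := CastellaGrossiSkinner2025.span_pow_mul_sq_le_charIdeal_torsion_of_thm652_stabilized h652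
      hyp D C X
    haveI : IsNoetherian (IwasawaAlgebra p) X.X := isNoetherian_of_isNoetherianRing_of_finite _ _
    haveI : Module.Finite (IwasawaAlgebra p) (Submodule.torsion (IwasawaAlgebra p) X.X) := inferInstance
    haveI : Module.Finite (IwasawaAlgebra p) (D.S ⧸ CastellaGrossiLeeSkinner2022.stabilizedHeegnerModule D C) :=
      inferInstance
    -- K1μ (THE open atom) + the sharp promotion (p613811) at `Q := 𝔖/Λκ_∞(C)`
    have hμ := hμC W p K hX hns hcm hK hodd h3 hHN hHp hirr κ hκ γ hγ jbar D C X hfinS hfinX htorC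
    have hsq : CastellaGrossiLeeSkinner2022.stabilizedHeegnerCharIdeal D C ^ 2 ≤
        Module.charIdeal (IwasawaAlgebra p) (Submodule.torsion (IwasawaAlgebra p) X.X) :=
      IwasawaAlgebra.sq_charIdeal_le_charIdeal_of_span_p_pow_mul_le_of_lengthAt_le_two_mul
        (Submodule.torsion_isTorsion (R := IwasawaAlgebra p) (M := X.X)) htorC hμ hm
    -- torsion of `𝔖/ℋ_F` from the reverse inclusion; the `e = 0` ideal transfer from the sharp forward one
    have htor : Module.IsTorsion (IwasawaAlgebra p) (D.S ⧸ heegnerModule D F) :=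
      isTorsion_quotient_heegnerModule_of_smul_stabilizedHeegnerModule_le D F C hg hrev htorC
    have henv : heegnerCharIdeal D F ≤ CastellaGrossiLeeSkinner2022.stabilizedHeegnerCharIdeal D C :=
      heegnerCharIdeal_le_stabilizedHeegnerCharIdeal_of_le D F C htor hfwd
    exact ⟨jbar, D, F, X, hFDt, le_trans (Ideal.pow_right_mono henv 2) hsq⟩
  · obtain ⟨D, F, X, hF, hle⟩ := s_cop hMZ W p K hX hns hcm hK hodd h3 hHN hHp hirr κ hκ γ hγ Dt H ιC jbar hc hrk
      hfin hhK
    exact ⟨jbar, D, F, X, hF, hle⟩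

/-- **The v8 composition, K1 as a hypothesis (v9)**: the crux BY NAME from s_cop (proved) and K1. The composed line
from the ONE stub is `HowardContainmentLightFrameX10bPinnedOfPrint_of_stubs` in §12. -/
theorem HowardContainmentLightFrameX10bPinnedOfPrint_of_kolyvaginBound (hK1 : Stmt.kolyvaginBoundAtEisensteinPrimes) :
    HowardContainmentLightFrameX10bPinnedOfPrint :=
  (HowardContainmentLightFrameX10bPinnedOfPrint_of_muInequalityStabilized stub_coprimeTied
    (muInequalityStabilized_of_kolyvaginBound hK1) : Goal)

/-! ## §5 A PROVED rung for S1 (the `m`-uniformity device behind K1): the Eisenstein-tame twist identity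

S1 ("Eisenstein-tame control", card §K1) claims the local / control error terms at `q_m = T^m + p` are bounded
independently of `m`.  Their algebraic kernel is the identity below: modulo `q_m`, the twist error `γ^{p^t} − 1`
(`γ ↦ 1 + T`) is a UNIT times `T^{p^t}` as soon as `p^t ≤ m`, so on every `Λ/(q_m)`-module its kernel and cokernel
are those of `T^{p^t}` — the same for all `m`.  (On `Λ/(q_m) ≅ ℤ_p[π]`, `π^m = −p`, this is `v_π((1+π)^{p^t} − 1) = p^t`.) -/

/-- [folklore] For `p^t ≤ m`: `(1+T)^{p^t} − 1 = ε·T^{p^t} + q_m·G` in `Λ = ℤ_p⟦T⟧` with `ε ∈ Λ^×`. -/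
theorem exists_one_add_X_pow_sub_one_eq (p : ℕ) [Fact p.Prime] (t m : ℕ) (hm : p ^ t ≤ m) :
    ∃ ε G : IwasawaAlgebra p, IsUnit ε ∧
      ((1 + PowerSeries.X : IwasawaAlgebra p) ^ (p ^ t) - 1 =
        ε * PowerSeries.X ^ (p ^ t) + (PowerSeries.X ^ m + PowerSeries.C (p : ℤ_[p]) : IwasawaAlgebra p) * G) := by
  have hp : p.Prime := Fact.out
  obtain ⟨k, rfl⟩ := Nat.exists_eq_add_of_le hm
  obtain ⟨r, hr⟩ := exists_add_pow_prime_pow_eq hp (PowerSeries.X : IwasawaAlgebra p) 1 t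
  refine ⟨1 - PowerSeries.X ^ (k + 1) * r, PowerSeries.X * r, ?_, ?_⟩
  · exact PowerSeries.isUnit_iff_constantCoeff.mpr (by simp)
  · have hpC : (p : IwasawaAlgebra p) = (PowerSeries.X ^ (p ^ t + k) + PowerSeries.C (p : ℤ_[p]) : IwasawaAlgebra p)
        - PowerSeries.X ^ (p ^ t + k) := by
      rw [map_natCast]; ring
    rw [add_comm (1 : IwasawaAlgebra p) PowerSeries.X, hr, hpC]
    ring

/-- [folklore] The module form S1 uses: on a `Λ`-module killed by `q_m` (`p^t ≤ m`) the twist error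
`(1+T)^{p^t} − 1` acts as `ε • T^{p^t}` for a unit `ε` — in particular its kernel is the `T^{p^t}`-torsion,
INDEPENDENT of `m`. -/
theorem twistError_smul_eq_unit_smul_X_pow_smul {p : ℕ} [Fact p.Prime] {t m : ℕ} (hm : p ^ t ≤ m)
    {M : Type*} [AddCommGroup M] [Module (IwasawaAlgebra p) M] (hM : ∀ x : M, (PowerSeries.X ^ m + PowerSeries.C (p : ℤ_[p]) : IwasawaAlgebra p) • x = 0) :
    ∃ ε : IwasawaAlgebra p, IsUnit ε ∧ ∀ x : M,
      (((1 + PowerSeries.X : IwasawaAlgebra p) ^ (p ^ t) - 1) • x =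
        ε • ((PowerSeries.X : IwasawaAlgebra p) ^ (p ^ t) • x)) := by
  obtain ⟨ε, G, hε, h⟩ := exists_one_add_X_pow_sub_one_eq p t m hm
  refine ⟨ε, hε, fun x ↦ ?_⟩
  rw [h, add_smul, mul_smul, mul_comm (PowerSeries.X ^ m + PowerSeries.C (p : ℤ_[p]) : IwasawaAlgebra p) G, mul_smul, hM, smul_zero, add_zero]

/-- [folklore] Corollary: on a `Λ/(q_m)`-module, `((1+T)^{p^t} − 1) • x = 0 ↔ T^{p^t} • x = 0` (`p^t ≤ m`). -/
theorem twistError_smul_eq_zero_iff {p : ℕ} [Fact p.Prime] {t m : ℕ} (hm : p ^ t ≤ m)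
    {M : Type*} [AddCommGroup M] [Module (IwasawaAlgebra p) M] (hM : ∀ x : M, (PowerSeries.X ^ m + PowerSeries.C (p : ℤ_[p]) : IwasawaAlgebra p) • x = 0) (x : M) :
    (((1 + PowerSeries.X : IwasawaAlgebra p) ^ (p ^ t) - 1) • x = 0 ↔
      (PowerSeries.X : IwasawaAlgebra p) ^ (p ^ t) • x = 0) := by
  obtain ⟨ε, hε, h⟩ := twistError_smul_eq_unit_smul_X_pow_smul hm hM
  rw [h x, hε.smul_eq_zero]


/-! ## §6 WITNESS FORM of K1 (PROVED bookkeeping): what the Galois side must deliver at `q_m`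

K1 is consumed through an INTERFACE (`SpecWitness`), not through definitions of specialised Selmer groups
(those are the card's definition requests D1/D2). Content: three module-algebra lemmas L0–L2 and the
reduction `Stmt.specWitnesses → Stmt.kolyvaginBoundAtEisensteinPrimes`. DESIGN CONSTRAINT recorded by the
interface (g4, from MZ26 Thm 2.40 vs BCGS Thm 1.3.1): the control errors enter only through the CARDINALITY
of `coker f` / `ker h` — an error "annihilated by p^c" has `S_m`-length `c·m` at `S_m = Λ/q_m` and would
survive `÷ m` in K1μ; so S1 must be a cardinality-bounded control theorem and S2 an error-free DVR bound. -/

section Bookkeeping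

variable {R : Type*} [CommRing R]

/-- The natural map `N ⧸ I•N → X ⧸ I•X` induced by the inclusion of a submodule `N ≤ X`. -/
def quotSMulTopMap (I : Ideal R) {X : Type*} [AddCommGroup X] [Module R X] (N : Submodule R X) :
    (N ⧸ (I • (⊤ : Submodule R N))) →ₗ[R] (X ⧸ (I • (⊤ : Submodule R X))) :=
  Submodule.mapQ _ _ N.subtype (Submodule.map_le_iff_le_comap.1 (by
    rw [Submodule.map_smul'', Submodule.map_top, Submodule.range_subtype]
    exact Submodule.smul_mono le_rfl le_top))

@[simp]
theorem quotSMulTopMap_mk (I : Ideal R) {X : Type*} [AddCommGroup X] [Module R X]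
    (N : Submodule R X) (n : N) :
    quotSMulTopMap I N (Submodule.Quotient.mk n) = Submodule.Quotient.mk (n : X) :=
  rfl

/-- **L0 (Tor-vanishing).** For a domain `R`, `q ≠ 0` and `N = torsion_R X`, the natural map
`N ⧸ qN → X ⧸ qX` is injective: if `n = q • y` with `n` torsion then `y` is torsion
(`(X/N)[q] = 0`, `X/N` being torsion-free). -/
theorem quotSMulTopMap_torsion_injective [IsDomain R] {X : Type*} [AddCommGroup X] [Module R X]
    {q : R} (hq : q ≠ 0) :
    Function.Injective (quotSMulTopMap (Ideal.span {q}) (Submodule.torsion R X)) := by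
  rw [injective_iff_map_eq_zero]
  intro x hx
  obtain ⟨n, rfl⟩ := Submodule.Quotient.mk_surjective _ x
  rw [quotSMulTopMap_mk, Submodule.Quotient.mk_eq_zero, Submodule.ideal_span_singleton_smul,
    Submodule.mem_smul_pointwise_iff_exists] at hx
  obtain ⟨y, -, hy⟩ := hx
  have hy_tors : y ∈ Submodule.torsion R X := by
    obtain ⟨a, ha⟩ := (Submodule.mem_torsion_iff (n : X)).1 n.2
    refine (Submodule.mem_torsion_iff y).2 ⟨a * ⟨q, mem_nonZeroDivisors_of_ne_zero hq⟩, ?_⟩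
    rw [Submonoid.smul_def, Submonoid.coe_mul, mul_smul, hy, ← Submonoid.smul_def]
    exact ha
  rw [Submodule.Quotient.mk_eq_zero, Submodule.ideal_span_singleton_smul,
    Submodule.mem_smul_pointwise_iff_exists]
  refine ⟨⟨y, hy_tors⟩, Submodule.mem_top, ?_⟩
  apply Subtype.ext
  simpa using hy

/-- **L1 (torsion transport along control maps).** If `ι : A → B` is an injective linear map from a
FINITE module `A` and `h : B → C` is linear with finite kernel, then
`#A ≤ #ker h · #(ℤ-torsion of C)`: the composite `h ∘ ι` has kernel embedding into `ker h` and image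
inside the torsion subgroup of `C` (its source being finite). Only the CARDINALITY of `ker h` enters —
an "annihilated by `p^c`" error would not do. -/
theorem card_le_card_ker_mul_card_torsion {A B C : Type*} [AddCommGroup A] [Module R A]
    [AddCommGroup B] [Module R B] [AddCommGroup C] [Module R C]
    (ι : A →ₗ[R] B) (hι : Function.Injective ι) (h : B →ₗ[R] C) [Finite A]
    [Finite (LinearMap.ker h)] [Finite (AddCommGroup.torsion C)] :
    Nat.card A ≤ Nat.card (LinearMap.ker h) * Nat.card (AddCommGroup.torsion C) := by
  set g : A →ₗ[R] C := h ∘ₗ ι with hg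
  have h1 : Nat.card A = Nat.card (LinearMap.ker g) * Nat.card (LinearMap.range g) := by
    rw [Submodule.card_eq_card_quotient_mul_card (LinearMap.ker g),
      Nat.card_congr (LinearMap.quotKerEquivRange g).toEquiv]
  have h2 : Nat.card (LinearMap.ker g) ≤ Nat.card (LinearMap.ker h) := by
    refine Nat.card_le_card_of_injective
      (fun x => ⟨ι x.1, by
        have hx : g x.1 = 0 := LinearMap.mem_ker.1 x.2
        exact LinearMap.mem_ker.2 (by simpa only [hg, LinearMap.comp_apply] using hx)⟩) ?_
    intro x y hxy
    apply Subtype.ext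
    apply hι
    simpa using congrArg Subtype.val hxy
  have h3 : Nat.card (LinearMap.range g) ≤ Nat.card (AddCommGroup.torsion C) := by
    refine Nat.card_le_card_of_injective (fun x => ⟨x.1, ?_⟩) ?_
    · obtain ⟨a, ha⟩ := LinearMap.mem_range.1 x.2
      rw [← ha]
      exact g.toAddMonoidHom.isOfFinAddOrder (isOfFinAddOrder_of_finite a)
    · intro x y hxy
      apply Subtype.ext
      simpa using congrArg Subtype.val hxy
  rw [h1]
  exact Nat.mul_le_mul h2 h3

/-- **L2 (index transport for the Heegner class).** Let `f : S → H` be linear with FINITE cokernel,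
`I • H = 0`, `L ≤ S` a submodule with `f(L) ⊆ R ∙ κ₁`. Then
`#(H ⧸ R∙κ₁) ≤ #(H ⧸ range f) · #((S ⧸ L) ⧸ I•(S ⧸ L))`
(third isomorphism theorem twice; only the CARDINALITY of `coker f` enters). -/
theorem card_quot_span_singleton_le {S H : Type*} [AddCommGroup S] [Module R S]
    [AddCommGroup H] [Module R H] (f : S →ₗ[R] H) (L : Submodule R S) (I : Ideal R) (κ₁ : H)
    (hI : I • (⊤ : Submodule R H) = ⊥) (hL : L.map f ≤ R ∙ κ₁)
    [Finite (H ⧸ LinearMap.range f)] [Finite ((S ⧸ L) ⧸ (I • (⊤ : Submodule R (S ⧸ L))))] :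
    Nat.card (H ⧸ (R ∙ κ₁)) ≤
      Nat.card (H ⧸ LinearMap.range f) * Nat.card ((S ⧸ L) ⧸ (I • (⊤ : Submodule R (S ⧸ L)))) := by
  set K₁ : Submodule R H := R ∙ κ₁ with hK₁
  set A : Submodule R H := LinearMap.range f with hA
  rw [← Submodule.card_quotient_mul_card_quotient (A ⊔ K₁) K₁ le_sup_right, mul_comm]
  apply Nat.mul_le_mul
  · -- `#(H ⧸ (A ⊔ K₁)) ≤ #(H ⧸ A)` along the surjection `factor`.
    refine Nat.card_le_card_of_surjective (Submodule.factor (le_sup_left : A ≤ A ⊔ K₁)) ?_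
    intro x
    obtain ⟨y, rfl⟩ := Submodule.Quotient.mk_surjective _ x
    exact ⟨Submodule.Quotient.mk y, rfl⟩
  · -- `(A ⊔ K₁)/K₁ = range (mkQ ∘ f)`, a quotient of `S ⧸ (L ⊔ I•S) ≅ (S ⧸ L) ⧸ I•(S ⧸ L)`.
    have hmap : (A ⊔ K₁).map K₁.mkQ = LinearMap.range (K₁.mkQ ∘ₗ f) := by
      rw [Submodule.map_sup, Submodule.mkQ_map_self, sup_bot_eq, LinearMap.range_comp, hA]
    have hker : L ⊔ I • (⊤ : Submodule R S) ≤ LinearMap.ker (K₁.mkQ ∘ₗ f) := by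
      refine sup_le ?_ ?_
      · intro x hx
        rw [LinearMap.mem_ker, LinearMap.comp_apply, Submodule.mkQ_apply,
          Submodule.Quotient.mk_eq_zero]
        exact hL ⟨x, hx, rfl⟩
      · rw [Submodule.smul_le]
        intro a ha x _
        rw [LinearMap.mem_ker, LinearMap.comp_apply, Submodule.mkQ_apply,
          Submodule.Quotient.mk_eq_zero, map_smul]
        have : a • f x ∈ I • (⊤ : Submodule R H) := Submodule.smul_mem_smul ha Submodule.mem_top
        rw [hI, Submodule.mem_bot] at this
        rw [this]
        exact zero_mem _
    have hquot : (L ⊔ I • (⊤ : Submodule R S)).map L.mkQ = I • (⊤ : Submodule R (S ⧸ L)) := by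
      rw [Submodule.map_sup, Submodule.mkQ_map_self, bot_sup_eq, Submodule.map_smul'',
        Submodule.map_top, Submodule.range_mkQ]
    have e : ((S ⧸ L) ⧸ (I • (⊤ : Submodule R (S ⧸ L)))) ≃ₗ[R] S ⧸ (L ⊔ I • (⊤ : Submodule R S)) :=
      (Submodule.quotEquivOfEq _ _ hquot.symm) ≪≫ₗ
        Submodule.quotientQuotientEquivQuotient L (L ⊔ I • ⊤) le_sup_left
    haveI : Finite (S ⧸ (L ⊔ I • (⊤ : Submodule R S))) := Finite.of_equiv _ e.toEquiv
    rw [hmap, ← Nat.card_congr (LinearMap.quotKerEquivRange (K₁.mkQ ∘ₗ f)).toEquiv,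
      Nat.card_congr e.toEquiv]
    refine Nat.card_le_card_of_surjective (Submodule.factor hker) ?_
    intro x
    obtain ⟨y, rfl⟩ := Submodule.Quotient.mk_surjective _ x
    exact ⟨Submodule.Quotient.mk y, rfl⟩

/-- **Witness form of K1 at one level `q` (D1/D2-shaped abstract data).** What the Galois side must
deliver at the Eisenstein prime `q = q_m`: a compact specialised Selmer module `H` (an `R/q`-module)
receiving `𝔖` by a control map `f` with cokernel of CARDINALITY `≤ c`, carrying the specialised class
`κ₁` with `f(Λκ_∞(C)) ⊆ R∙κ₁`; the dual discrete specialised Selmer module `Xq` receiving `𝒳/q𝒳` by a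
control map `h` with kernel of CARDINALITY `≤ c`; and the ERROR-FREE DVR Kolyvagin bound in structure
form `#Xq_tors ≤ #(H/R∙κ₁)²` (MZ26 Thm 2.40 shape: `H¹_ℱ(K,A_q) ≅ Φ/𝓡 ⊕ M ⊕ M`, `ℓ(M) ≤ ℓ(H/𝓡κ₁)`).
This is NOT a definition of those Selmer modules (that is the card's definition request D1/D2); it is
the interface through which K1 consumes them — and it records the one design constraint found in g4:
control errors must be bounded in CARDINALITY (S_m-length), not merely annihilated by `p^c`. -/
structure SpecWitness (R : Type*) [CommRing R] (S X : Type*) [AddCommGroup S] [Module R S]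
    [AddCommGroup X] [Module R X] (L : Submodule R S) (q : R) (c : ℕ) where
  /-- the compact specialised Selmer module `H¹_ℱ(K, T ⊗ R/q)`. -/
  H : Type
  [addCommGroupH : AddCommGroup H]
  [moduleH : Module R H]
  /-- the (Pontryagin dual of the) discrete specialised Selmer module. -/
  Xq : Type
  [addCommGroupXq : AddCommGroup Xq]
  [moduleXq : Module R Xq]
  /-- the specialised stabilised Heegner–Kolyvagin class `κ_q(1)`. -/
  κ₁ : H
  /-- compact control `𝔖 → H`. -/
  f : S →ₗ[R] H
  /-- dual discrete control `𝒳/q𝒳 → Xq`. -/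
  h : (X ⧸ ((Ideal.span {q} : Ideal R) • (⊤ : Submodule R X))) →ₗ[R] Xq
  /-- `H` is killed by `q`. -/
  smul_top_eq_bot : (Ideal.span {q} : Ideal R) • (⊤ : Submodule R H) = ⊥
  /-- `f` maps the `Λ`-adic class module into the line of `κ₁`. -/
  map_le : L.map f ≤ R ∙ κ₁
  /-- (S1-i) compact control with cokernel of cardinality `≤ c`. -/
  finite_coker : Finite (H ⧸ LinearMap.range f)
  card_coker_le : Nat.card (H ⧸ LinearMap.range f) ≤ c
  /-- (S1-ii) discrete control with kernel of cardinality `≤ c`. -/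
  finite_ker : Finite (LinearMap.ker h)
  card_ker_le : Nat.card (LinearMap.ker h) ≤ c
  /-- finiteness of `Xq_tors` and of `H / R∙κ₁` (`κ₁` non-torsion in the rank-one `H`). -/
  finite_torsion : Finite (AddCommGroup.torsion Xq)
  finite_quot : Finite (H ⧸ (R ∙ κ₁))
  /-- (S2) the error-free DVR Kolyvagin bound, structure form. -/
  card_torsion_le_sq : Nat.card (AddCommGroup.torsion Xq) ≤ Nat.card (H ⧸ (R ∙ κ₁)) ^ 2

attribute [instance] SpecWitness.addCommGroupH SpecWitness.moduleH SpecWitness.addCommGroupXq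
  SpecWitness.moduleXq

/-- **K1 at one level from a witness (PROVED).**
`#(𝒳_tors / q 𝒳_tors) ≤ c³ · #((𝔖/L) / q)²` — L0 + L1 + the witness's S2 bound + L2. -/
theorem card_quot_torsion_le_of_specWitness [IsDomain R] {S X : Type*} [AddCommGroup S]
    [Module R S] [AddCommGroup X] [Module R X] {L : Submodule R S} {q : R} (hq : q ≠ 0) {c : ℕ}
    (w : SpecWitness R S X L q c)
    [Finite (Submodule.torsion R X ⧸
      ((Ideal.span {q} : Ideal R) • (⊤ : Submodule R (Submodule.torsion R X))))]
    [Finite ((S ⧸ L) ⧸ ((Ideal.span {q} : Ideal R) • (⊤ : Submodule R (S ⧸ L))))] :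
    Nat.card (Submodule.torsion R X ⧸
        ((Ideal.span {q} : Ideal R) • (⊤ : Submodule R (Submodule.torsion R X)))) ≤
      c ^ 3 * Nat.card ((S ⧸ L) ⧸ ((Ideal.span {q} : Ideal R) • (⊤ : Submodule R (S ⧸ L)))) ^ 2 := by
  haveI := w.finite_ker
  haveI := w.finite_torsion
  haveI := w.finite_coker
  haveI := w.finite_quot
  have h1 := card_le_card_ker_mul_card_torsion (quotSMulTopMap (Ideal.span {q}) (Submodule.torsion R X))
    (quotSMulTopMap_torsion_injective hq) w.h
  have h2 := card_quot_span_singleton_le w.f L (Ideal.span {q}) w.κ₁ w.smul_top_eq_bot w.map_le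
  calc _ ≤ Nat.card (LinearMap.ker w.h) * Nat.card (AddCommGroup.torsion w.Xq) := h1
    _ ≤ c * Nat.card (w.H ⧸ (R ∙ w.κ₁)) ^ 2 := Nat.mul_le_mul w.card_ker_le w.card_torsion_le_sq
    _ ≤ c * (c * Nat.card ((S ⧸ L) ⧸ ((Ideal.span {q} : Ideal R) • (⊤ : Submodule R (S ⧸ L))))) ^ 2 :=
        Nat.mul_le_mul_left _ (Nat.pow_le_pow_left (le_trans h2 (Nat.mul_le_mul_right _ w.card_coker_le)) 2)
    _ = _ := by ring

/-- `q_m = T^m + p ≠ 0` in `Λ`. -/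
theorem qm_ne_zero (p : ℕ) [hp : Fact p.Prime] (m : ℕ) :
    (PowerSeries.X ^ m + PowerSeries.C (p : ℤ_[p]) : Literature.NumberTheory.EllipticCurves.IwasawaAlgebra p) ≠ 0 := by
  intro h
  have h1 := congrArg PowerSeries.constantCoeff h
  rcases Nat.eq_zero_or_pos m with rfl | hm
  · simp only [pow_zero, map_add, map_one, PowerSeries.constantCoeff_C, map_zero] at h1
    have : ((p + 1 : ℕ) : ℤ_[p]) ≠ 0 := Nat.cast_ne_zero.2 (Nat.succ_ne_zero p)
    exact this (by rw [Nat.cast_succ, add_comm]; exact h1)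
  · simp only [map_add, map_pow, PowerSeries.constantCoeff_X, zero_pow hm.ne', zero_add,
      PowerSeries.constantCoeff_C, map_zero] at h1
    exact hp.out.ne_zero (by exact_mod_cast h1)

end Bookkeeping

/-- **K1 in witness form (the S1 ∧ S2 deliverable).** On the light frame: for `m ≫ 0` a `SpecWitness` at
`q_m = T^m + p` with control constant `p^c`, `c` uniform in `m` (S1 = the two control maps with
CARDINALITY-bounded coker/ker — Eisenstein-tame control, §5 supplies its algebraic kernel; S2 = the field
`card_torsion_le_sq` — MZ26 Thm 2.40-type error-free DVR bound for the specialised stabilised system at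
`𝓡 = Λ/q_m`, scalars `1+pℤ_p` from `ClassX10.hasPadicScalarImage_of_not_surj`, re-proved without MZ26
Ass. 2.1(3) `p ∤ h_K`). [cite: Howard2004HeegnerKolyvagin, proof of Thm. 2.2.10] [cite: MastellaZerman2026, Thm. 2.40]
[cite: MazurRubin2004KolyvaginSystems, Thm. 5.2.2] -/
def Stmt.specWitnesses : Prop :=
  ∀ (W : WeierstrassCurve ℚ) [W.IsElliptic] [W.IsGloballyMinimal] (p : ℕ) [Fact p.Prime]
    [NeZero (W.conductorNorm ℤ)] (K : Type) [Field K] [NumberField K],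
    ClassX10 W p → ¬ Surj W 3 → ¬ W.HasCM →
    IsImaginaryQuadratic K → Odd (NumberField.discr K) → NumberField.discr K ≠ -3 →
    SatisfiesHeegnerHypothesis (W.conductorNorm ℤ) K → SatisfiesHeegnerHypothesis p K →
    (W.baseChange K).HasIrreducibleModPGaloisRep p →
    ∀ (κ : ZpExtension K p), κ.IsAnticyclotomic → ∀ (γ : Field.absoluteGaloisGroup K),
    κ.IsTopGenerator γ →
    ∀ (jbar : AlgebraicClosure K →+* ℂ) (D : (W.baseChange K).LambdaAdicSelmerData κ γ)
      (C : CastellaGrossiLeeSkinner2022.StabilizedHeegnerData (W.conductorNorm ℤ) W K κ jbar)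
      (X : (W.baseChange K).SelmerDualData κ γ),
    Module.Finite (IwasawaAlgebra p) D.S → Module.Finite (IwasawaAlgebra p) X.X →
    Module.IsTorsion (IwasawaAlgebra p) (D.S ⧸ CastellaGrossiLeeSkinner2022.stabilizedHeegnerModule D C) →
    ∃ c m₀ : ℕ, ∀ m : ℕ, m₀ ≤ m →
      Nonempty (SpecWitness (IwasawaAlgebra p) D.S X.X
        (CastellaGrossiLeeSkinner2022.stabilizedHeegnerModule D C)
        (PowerSeries.X ^ m + PowerSeries.C (p : ℤ_[p]) : IwasawaAlgebra p) (p ^ c))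

/-- **Witness form ⟹ K1 (PROVED).** [cite: Howard2004HeegnerKolyvagin, proof of Thm. 2.2.10] -/
theorem kolyvaginBound_of_specWitnesses (hW : Stmt.specWitnesses) :
    Stmt.kolyvaginBoundAtEisensteinPrimes := by
  intro W _ _ p _ _ K _ _ hX hns hcm hK hodd h3 hHN hHp hirr κ hκ γ hγ jbar D C X hfinS hfinX htorC
  haveI := hfinS
  haveI := hfinX
  haveI : IsNoetherian (IwasawaAlgebra p) X.X := isNoetherian_of_isNoetherianRing_of_finite _ _
  haveI : Module.Finite (IwasawaAlgebra p) (Submodule.torsion (IwasawaAlgebra p) X.X) := inferInstance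
  haveI : Module.Finite (IwasawaAlgebra p) (D.S ⧸ CastellaGrossiLeeSkinner2022.stabilizedHeegnerModule D C) :=
    inferInstance
  obtain ⟨c, m₀, hw⟩ := hW W p K hX hns hcm hK hodd h3 hHN hHp hirr κ hκ γ hγ jbar D C X hfinS hfinX htorC
  obtain ⟨B, m₁, -, h1⟩ := IwasawaAlgebra.exists_card_quotSMulTop_qm_bounds p _
    (Submodule.torsion_isTorsion (R := IwasawaAlgebra p) (M := X.X))
  obtain ⟨B', m₂, -, h2⟩ := IwasawaAlgebra.exists_card_quotSMulTop_qm_bounds p _ htorC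
  refine ⟨3 * c, max m₀ (max m₁ m₂), fun m hm => ?_⟩
  obtain ⟨w⟩ := hw m (le_trans (le_max_left _ _) hm)
  haveI := (h1 m (le_trans (le_trans (le_max_left _ _) (le_max_right _ _)) hm)).1
  haveI := (h2 m (le_trans (le_trans (le_max_right _ _) (le_max_right _ _)) hm)).1
  calc _ ≤ _ := card_quot_torsion_le_of_specWitness (qm_ne_zero p m) w
    _ = _ := by rw [← pow_mul, mul_comm c 3]

/-! ## §7 Socket adapter to the LEAD's registered stub (rev-35 skeleton of record)

x10b-p2 LEAD g3's line of record `Cruxes/HowardContainmentAnyClassNumberX10b/Lines/torsion_depth_x10b_pinned_rev35.lean`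
(10:52Z) re-cut its ONE open stub to `TorsionDepthX10bPinned.Stmt.muInequalityStabilized` — K1μ's statement with three
extra hypotheses (`rank E(K) = 1`, `Ш[p^∞]` finite, `p ∣ h_K`: the case MZ26 Cor 4.6 does not cover). That Prop is copied
VERBATIM below as `Stmt.muInequalityStabilizedLead` (so it is definitionally the LEAD's stub statement; Cruxes workfiles
are not imported into one another), and the adapters record that this line's K1 — in either spelling — closes it. -/

/-- VERBATIM copy of `…Cruxes.HowardContainmentLightFrameX10bPinnedOfPrint.TorsionDepthX10bPinned.Stmt.muInequalityStabilized`
(rev-35 skeleton of record, x10b-p2 LEAD g3). -/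
def Stmt.muInequalityStabilizedLead : Prop :=
    ∀ (W : WeierstrassCurve ℚ) [W.IsElliptic] [W.IsGloballyMinimal] (p : ℕ) [Fact p.Prime]
      [NeZero (W.conductorNorm ℤ)] (K : Type) [Field K] [NumberField K],
      ClassX10 W p → ¬ Surj W 3 → ¬ W.HasCM →
      IsImaginaryQuadratic K → Odd (NumberField.discr K) → NumberField.discr K ≠ -3 →
      SatisfiesHeegnerHypothesis (W.conductorNorm ℤ) K → SatisfiesHeegnerHypothesis p K →
      (W.baseChange K).HasIrreducibleModPGaloisRep p →
      ∀ (κ : ZpExtension K p), κ.IsAnticyclotomic → ∀ (γ : Field.absoluteGaloisGroup K),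
      κ.IsTopGenerator γ →
      (W.baseChange K).mordellWeilRank = 1 →
      Finite (AddCommGroup.primaryComponent (W.baseChange K).sha p) →
      p ∣ NumberField.classNumber K →
      ∀ (jbar : AlgebraicClosure K →+* ℂ) (D : (W.baseChange K).LambdaAdicSelmerData κ γ)
        (C : CastellaGrossiLeeSkinner2022.StabilizedHeegnerData (W.conductorNorm ℤ) W K κ jbar)
        (X : (W.baseChange K).SelmerDualData κ γ),
      Module.Finite (IwasawaAlgebra p) D.S → Module.Finite (IwasawaAlgebra p) X.X →
      Module.IsTorsion (IwasawaAlgebra p) (D.S ⧸ CastellaGrossiLeeSkinner2022.stabilizedHeegnerModule D C) →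
      ∀ 𝔭 : PrimeSpectrum (IwasawaAlgebra p), 𝔭.asIdeal = Ideal.span {(p : IwasawaAlgebra p)} →
        Module.lengthAt (IwasawaAlgebra p) (Submodule.torsion (IwasawaAlgebra p) X.X) 𝔭 ≤
          2 * Module.lengthAt (IwasawaAlgebra p)
            (D.S ⧸ CastellaGrossiLeeSkinner2022.stabilizedHeegnerModule D C) 𝔭

/-- K1μ (h_K-free, rank-free) ⟹ the LEAD's registered stub (PROVED: discard the three extra hypotheses). -/
theorem muInequalityStabilizedLead_of_muInequalityStabilized (h : Stmt.muInequalityStabilized) :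
    Stmt.muInequalityStabilizedLead := by
  intro W _ _ p _ _ K _ _ hX h3 hCM hK hodd hd3 hHN hHp hirr κ hκ γ hγ _ _ _ jbar D C X hDS hXX htorC 𝔭 h𝔭
  exact h W p K hX h3 hCM hK hodd hd3 hHN hHp hirr κ hκ γ hγ jbar D C X hDS hXX htorC 𝔭 h𝔭

/-- K1 (cardinality spelling) ⟹ the LEAD's registered stub (PROVED). -/
theorem muInequalityStabilizedLead_of_kolyvaginBound (h : Stmt.kolyvaginBoundAtEisensteinPrimes) :
    Stmt.muInequalityStabilizedLead :=
  muInequalityStabilizedLead_of_muInequalityStabilized (muInequalityStabilized_of_kolyvaginBound h)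

/-- the §6 witness form ⟹ the LEAD's registered stub (PROVED). -/
theorem muInequalityStabilizedLead_of_specWitnesses (h : Stmt.specWitnesses) :
    Stmt.muInequalityStabilizedLead :=
  muInequalityStabilizedLead_of_kolyvaginBound (kolyvaginBound_of_specWitnesses h)

/-! ## §8 Kernel certificates against the LANDED letters (v7, after the 10:43–10:55Z landings) and the
"ONE ITEM, TWO ROWS" plug

Since 10:43Z the tree carries, route-independently (cell `pub/bsd-print-x9`, x9-p1-w2 g3 / x10b-p2 g3):
`Theorems.HeegnerMuPartStabilized.MuPartStabilizedOfPrint` (the FRAME-FREE μ-residual in the stabilised currency —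
K1μ with CGLS's `Thm413Hypotheses`, MZ's `HasPadicScalarImage`, `p ∣ h_K` as binders; both rows 9 (X9) and 10 (X10b)
specialise to it), `…muPartStabilizedOfPrint_of_card_quotSMulTop_qm_le` (frame-free K1, cardinality spelling ⟹ it),
and `Theorems.PrintX10bSharpMuStabilized.howardContainmentLightFrameX10bPinnedOfPrint_of_muStabilized` (the row-10
crux BY NAME from `Stmt.muInequalityStabilized`, the rev-35 letter). This section (a) certifies by `Iff.rfl` that §7's
copy IS the landed letter, (b) composes this line's K1 with the LANDED closer (a second sorry-free road to the crux
decl, through Theorems only), and (c) states the §6 witness form FRAME-FREE and proves it feeds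
`MuPartStabilizedOfPrint` — so ONE `SpecWitness` construction (D1) serves BOTH rows. -/

/-- (a) §7's verbatim copy is the landed rev-35 letter (kernel: `Iff.rfl`). -/
theorem muInequalityStabilizedLead_iff_landed :
    Stmt.muInequalityStabilizedLead ↔
      Summit.BirchSwinnertonDyer.BirchSwinnertonDyer.Theorems.PrintX10bSharpMuStabilized.Stmt.muInequalityStabilized :=
  Iff.rfl

/-- (b) K1 ⟹ the crux decl through the LANDED closer (p625072/p627241), no in-file composition used. -/
theorem crux_of_kolyvaginBound_via_landed (h : Stmt.kolyvaginBoundAtEisensteinPrimes) :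
    HowardContainmentLightFrameX10bPinnedOfPrint :=
  Summit.BirchSwinnertonDyer.BirchSwinnertonDyer.Theorems.PrintX10bSharpMuStabilized.howardContainmentLightFrameX10bPinnedOfPrint_of_muStabilized
    (muInequalityStabilizedLead_iff_landed.1 (muInequalityStabilizedLead_of_kolyvaginBound h))

/-- (b') the §6 witness form ⟹ the crux decl through the LANDED closer. -/
theorem crux_of_specWitnesses_via_landed (h : Stmt.specWitnesses) :
    HowardContainmentLightFrameX10bPinnedOfPrint :=
  crux_of_kolyvaginBound_via_landed (kolyvaginBound_of_specWitnesses h)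

/-- (c) the module-level core of §6, binder-free: witnesses at all large `m` ⟹ the uniform cardinality bound. -/
theorem exists_card_bound_of_specWitnesses (p : ℕ) [Fact p.Prime] {S X : Type} [AddCommGroup S]
    [Module (IwasawaAlgebra p) S] [AddCommGroup X] [Module (IwasawaAlgebra p) X]
    [Module.Finite (IwasawaAlgebra p) S] [Module.Finite (IwasawaAlgebra p) X]
    (L : Submodule (IwasawaAlgebra p) S) (hL : Module.IsTorsion (IwasawaAlgebra p) (S ⧸ L))
    (hW : ∃ c m₀ : ℕ, ∀ m : ℕ, m₀ ≤ m →
      Nonempty (SpecWitness (IwasawaAlgebra p) S X L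
        (PowerSeries.X ^ m + PowerSeries.C (p : ℤ_[p]) : IwasawaAlgebra p) (p ^ c))) :
    ∃ c m₀ : ℕ, ∀ m : ℕ, m₀ ≤ m →
      Nat.card (↥(Submodule.torsion (IwasawaAlgebra p) X) ⧸
        (Ideal.span {(PowerSeries.X ^ m + PowerSeries.C (p : ℤ_[p]) : IwasawaAlgebra p)} • ⊤ :
          Submodule (IwasawaAlgebra p) ↥(Submodule.torsion (IwasawaAlgebra p) X))) ≤
      p ^ c * Nat.card ((S ⧸ L) ⧸
        (Ideal.span {(PowerSeries.X ^ m + PowerSeries.C (p : ℤ_[p]) : IwasawaAlgebra p)} • ⊤ :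
          Submodule (IwasawaAlgebra p) (S ⧸ L))) ^ 2 := by
  haveI : IsNoetherian (IwasawaAlgebra p) X := isNoetherian_of_isNoetherianRing_of_finite _ _
  haveI : Module.Finite (IwasawaAlgebra p) (Submodule.torsion (IwasawaAlgebra p) X) := inferInstance
  haveI : Module.Finite (IwasawaAlgebra p) (S ⧸ L) := inferInstance
  obtain ⟨c, m₀, hw⟩ := hW
  obtain ⟨B, m₁, -, h1⟩ := IwasawaAlgebra.exists_card_quotSMulTop_qm_bounds p _
    (Submodule.torsion_isTorsion (R := IwasawaAlgebra p) (M := X))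
  obtain ⟨B', m₂, -, h2⟩ := IwasawaAlgebra.exists_card_quotSMulTop_qm_bounds p _ hL
  refine ⟨3 * c, max m₀ (max m₁ m₂), fun m hm => ?_⟩
  obtain ⟨w⟩ := hw m (le_trans (le_max_left _ _) hm)
  haveI := (h1 m (le_trans (le_trans (le_max_left _ _) (le_max_right _ _)) hm)).1
  haveI := (h2 m (le_trans (le_trans (le_max_right _ _) (le_max_right _ _)) hm)).1
  calc _ ≤ _ := card_quot_torsion_le_of_specWitness (qm_ne_zero p m) w
    _ = _ := by rw [← pow_mul, mul_comm c 3]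

/-- **K1 FRAME-FREE** ("one item, two rows"): VERBATIM the hypothesis `hKS` of the landed
`Theorems.HeegnerMuPartStabilized.muPartStabilizedOfPrint_of_card_quotSMulTop_qm_le` — the specialised Kolyvagin bound
at `q_m = T^m + p`, uniform in `m`, under the frame-free binders of `MuPartStabilizedOfPrint`. -/
def Stmt.kolyvaginBoundFrameFree : Prop :=
  ∀ (N : ℕ) [NeZero N] (W : WeierstrassCurve ℚ) [W.IsGloballyMinimal] (K : Type) [Field K] [NumberField K]
    (p : ℕ) [Fact p.Prime] (κ : ZpExtension K p) (γ : Field.absoluteGaloisGroup K)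
    (jbar : AlgebraicClosure K →+* ℂ),
    CastellaGrossiLeeSkinner2022.Thm413Hypotheses N W K p κ γ →
    ¬ W.HasCM → W.HasIrreducibleModPGaloisRep p → (W.baseChange K).HasIrreducibleModPGaloisRep p →
    MastellaZerman2026.HasPadicScalarImage W p → SatisfiesHeegnerHypothesis p K →
    p ∣ NumberField.classNumber K →
    ∀ (D : (W.baseChange K).LambdaAdicSelmerData κ γ)
      (C : CastellaGrossiLeeSkinner2022.StabilizedHeegnerData N W K κ jbar)
      (X : (W.baseChange K).SelmerDualData κ γ),
    Module.Finite (IwasawaAlgebra p) D.S → Module.Finite (IwasawaAlgebra p) X.X →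
    Module.IsTorsion (IwasawaAlgebra p) (D.S ⧸ CastellaGrossiLeeSkinner2022.stabilizedHeegnerModule D C) →
    ∃ C₀ m₀ : ℕ, ∀ m : ℕ, m₀ ≤ m →
      Nat.card (↥(Submodule.torsion (IwasawaAlgebra p) X.X) ⧸
        (Ideal.span {(PowerSeries.X ^ m + PowerSeries.C (p : ℤ_[p]) : IwasawaAlgebra p)} • ⊤ :
          Submodule (IwasawaAlgebra p) ↥(Submodule.torsion (IwasawaAlgebra p) X.X))) ≤
      p ^ C₀ * Nat.card ((D.S ⧸ CastellaGrossiLeeSkinner2022.stabilizedHeegnerModule D C) ⧸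
        (Ideal.span {(PowerSeries.X ^ m + PowerSeries.C (p : ℤ_[p]) : IwasawaAlgebra p)} • ⊤ :
          Submodule (IwasawaAlgebra p)
            (D.S ⧸ CastellaGrossiLeeSkinner2022.stabilizedHeegnerModule D C))) ^ 2

/-- **§6 witness form, FRAME-FREE**: under the binders of `MuPartStabilizedOfPrint`, for all large `m` a `SpecWitness`
at `q_m` with constant `p^c` exists. ONE construction of these (D1 of the card: S1 control + S2 DVR bound, no frame
vocabulary) serves rows 9 AND 10. -/
def Stmt.specWitnessesFrameFree : Prop :=
  ∀ (N : ℕ) [NeZero N] (W : WeierstrassCurve ℚ) [W.IsGloballyMinimal] (K : Type) [Field K] [NumberField K]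
    (p : ℕ) [Fact p.Prime] (κ : ZpExtension K p) (γ : Field.absoluteGaloisGroup K)
    (jbar : AlgebraicClosure K →+* ℂ),
    CastellaGrossiLeeSkinner2022.Thm413Hypotheses N W K p κ γ →
    ¬ W.HasCM → W.HasIrreducibleModPGaloisRep p → (W.baseChange K).HasIrreducibleModPGaloisRep p →
    MastellaZerman2026.HasPadicScalarImage W p → SatisfiesHeegnerHypothesis p K →
    p ∣ NumberField.classNumber K →
    ∀ (D : (W.baseChange K).LambdaAdicSelmerData κ γ)
      (C : CastellaGrossiLeeSkinner2022.StabilizedHeegnerData N W K κ jbar)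
      (X : (W.baseChange K).SelmerDualData κ γ),
    Module.Finite (IwasawaAlgebra p) D.S → Module.Finite (IwasawaAlgebra p) X.X →
    Module.IsTorsion (IwasawaAlgebra p) (D.S ⧸ CastellaGrossiLeeSkinner2022.stabilizedHeegnerModule D C) →
    ∃ c m₀ : ℕ, ∀ m : ℕ, m₀ ≤ m →
      Nonempty (SpecWitness (IwasawaAlgebra p) D.S X.X (CastellaGrossiLeeSkinner2022.stabilizedHeegnerModule D C)
        (PowerSeries.X ^ m + PowerSeries.C (p : ℤ_[p]) : IwasawaAlgebra p) (p ^ c))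

/-- frame-free witnesses ⟹ frame-free K1 (PROVED, the core (c)). -/
theorem kolyvaginBoundFrameFree_of_specWitnessesFrameFree (hW : Stmt.specWitnessesFrameFree) :
    Stmt.kolyvaginBoundFrameFree := by
  intro N _ W _ K _ _ p _ κ γ jbar hyp hcm hirr hirrK hsc hHp hhK D C X hfinS hfinX htorC
  haveI := hfinS
  haveI := hfinX
  exact exists_card_bound_of_specWitnesses p _ htorC
    (hW N W K p κ γ jbar hyp hcm hirr hirrK hsc hHp hhK D C X hfinS hfinX htorC)

/-- frame-free K1 ⟹ the landed frame-free μ-residual `MuPartStabilizedOfPrint` (the landed reduction, BY NAME). -/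
theorem muPartStabilizedOfPrint_of_kolyvaginBoundFrameFree (h : Stmt.kolyvaginBoundFrameFree) :
    Summit.BirchSwinnertonDyer.BirchSwinnertonDyer.Theorems.HeegnerMuPartStabilized.MuPartStabilizedOfPrint :=
  Summit.BirchSwinnertonDyer.BirchSwinnertonDyer.Theorems.HeegnerMuPartStabilized.muPartStabilizedOfPrint_of_card_quotSMulTop_qm_le
    h

/-- **ONE ITEM, TWO ROWS**: frame-free witnesses ⟹ `MuPartStabilizedOfPrint` (PROVED). -/
theorem muPartStabilizedOfPrint_of_specWitnessesFrameFree (h : Stmt.specWitnessesFrameFree) :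
    Summit.BirchSwinnertonDyer.BirchSwinnertonDyer.Theorems.HeegnerMuPartStabilized.MuPartStabilizedOfPrint :=
  muPartStabilizedOfPrint_of_kolyvaginBoundFrameFree (kolyvaginBoundFrameFree_of_specWitnessesFrameFree h)


/-! ## §9. ONE RESEARCH STATEMENT, THREE SOCKETS (kernel certificates against the closers LANDED 11:21Z)

With `Theorems/PrintX10bSplitClosersStabilized.lean` (x10b-p2 LEAD g3: `howardContainmentLightFrameX10bPinnedOfPrint_of_common :
MuPartStabilizedOfPrint → HowardContainmentLightFrameX10bPinnedOfPrint`, the X10b frame discharging `Thm413Hypotheses` /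
irreducibility / the MZ26 scalar clause) and `Theorems/PrintX9HowardContainmentLightFramePinnedOfPrintSharpOfMuStabilizedGeneric.lean`
(x9-p1-w2: `howardContainmentLightFramePinnedOfPrintSharp_of_muPartStabilizedOfPrint`) in the tree, the FRAME-FREE witness form
`Stmt.specWitnessesFrameFree` of §8 — the existence, for all large `m`, of ONE `SpecWitness` at `q_m = X^m + p` with `m`-uniform
cardinality constant — closes BY NAME (i) this route's crux stmt-27275, (ii) route PrintX9's crux
`HowardContainmentLightFramePinnedOfPrintSharp`, (iii) the shared μ-letter `MuPartStabilizedOfPrint` (§8). Nothing below uses a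
`sorry`; the only open content of the whole line remains the CONSTRUCTION of the witnesses (D1 = S1 cardinality-bounded control
+ S2 error-free DVR Kolyvagin-system bound at `Λ/q_m`, any `h_K`). The load-bearing stub of THIS skeleton stays the framed,
weaker K1 (`Stmt.kolyvaginBoundAtEisensteinPrimes`, the least statement closing 27275); §9 records that a prover who builds the
frame-free witnesses settles both rows at once. No summit statement is proved here; BSD is not proved by any of this. -/

/-- (i) frame-free witnesses ⟹ the X10b crux stmt-27275, by name, through the landed X10b closer. -/
theorem crux_of_specWitnessesFrameFree_via_landed (h : Stmt.specWitnessesFrameFree) :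
    HowardContainmentLightFrameX10bPinnedOfPrint :=
  Summit.BirchSwinnertonDyer.BirchSwinnertonDyer.Theorems.PrintX10bSplitStabilized.howardContainmentLightFrameX10bPinnedOfPrint_of_common
    (muPartStabilizedOfPrint_of_specWitnessesFrameFree h)

/-- (i') the same from the frame-free CARDINALITY bound (K1 frame-free = the landed `hKS` letter). -/
theorem crux_of_kolyvaginBoundFrameFree_via_landed (h : Stmt.kolyvaginBoundFrameFree) :
    HowardContainmentLightFrameX10bPinnedOfPrint :=
  Summit.BirchSwinnertonDyer.BirchSwinnertonDyer.Theorems.PrintX10bSplitStabilized.howardContainmentLightFrameX10bPinnedOfPrint_of_common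
    (muPartStabilizedOfPrint_of_kolyvaginBoundFrameFree h)

/-- (ii) frame-free witnesses ⟹ route PrintX9's crux `HowardContainmentLightFramePinnedOfPrintSharp`, by name, through the landed
X9 generic closer — ONE construction, TWO cruxes. -/
theorem x9crux_of_specWitnessesFrameFree_via_landed (h : Stmt.specWitnessesFrameFree) :
    Summit.BirchSwinnertonDyer.BirchSwinnertonDyer.Theses.PrintX9.HowardContainmentLightFramePinnedOfPrintSharp :=
  Summit.BirchSwinnertonDyer.BirchSwinnertonDyer.Theorems.PrintX9SharpMuStabilized.howardContainmentLightFramePinnedOfPrintSharp_of_muPartStabilizedOfPrint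
    (muPartStabilizedOfPrint_of_specWitnessesFrameFree h)

/-- (ii') and from the frame-free cardinality bound. -/
theorem x9crux_of_kolyvaginBoundFrameFree_via_landed (h : Stmt.kolyvaginBoundFrameFree) :
    Summit.BirchSwinnertonDyer.BirchSwinnertonDyer.Theses.PrintX9.HowardContainmentLightFramePinnedOfPrintSharp :=
  Summit.BirchSwinnertonDyer.BirchSwinnertonDyer.Theorems.PrintX9SharpMuStabilized.howardContainmentLightFramePinnedOfPrintSharp_of_muPartStabilizedOfPrint
    (muPartStabilizedOfPrint_of_kolyvaginBoundFrameFree h)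


/-! ## §10 (v10) THE POINTWISE CUT AND THE SHELLS ARE IN THE TREE — the ONE stub is the TREE shell

v9's §10–§11 (the pointwise predicate `HasSpecWitnesses p S X L` on ONE triple, the one pointwise theorem
`lengthAt_torsion_le_two_mul_of_hasSpecWitnesses`, the three quantifier shells and the certificates shell ⟹ letter) LANDED in
`Theorems/` (x9-p1-w2 g4, from this line's v8/v9 and the 11:56:27Z typing advice): `Theorems/PrintX9MuPartSpecWitnessDefs.lean`
(p632362) and `Theorems/PrintX9MuPartStabilizedOfSpecWitnesses.lean` (p633080); the row-10 closer from the L∃ letter landed as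
`Theorems/PrintX10bHowardContainmentLightFrameX10bOfMuCoherentPair.lean` (x10b-p2 LEAD g4, p631887). v10 cites them BY NAME and keeps
no copy. (§6–§9 keep v7/v8's own `SpecWitness` bookkeeping as the line's derivation record; the tree structure has the same fields
with `ℤ`-torsion `AddCommGroup.torsion Xq`, equal to `Λ`-torsion by p632713 `mem_addTorsion_iff_mem_torsion`.) -/

/-- **THE ONE STUB (v10, OPEN, load-bearing): spec witnesses at the road's own coherent pair — the TREE shell**
`HeegnerMuPartStabilized.SpecWitnessesCoherentPair` (p632362; = the kernel road of THE CUT v2's shared μ-item, plan g10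
12:02:33Z): for every print frame (CGLS `Thm413Hypotheses`, non-CM, (irr), (irr_K), MZ26 scalars, Heeg, `p ∣ h_K`, `p ∤ N`, the
two tower inputs) and every `(Dt, β, D, X)`, a stabilised datum `C` and a Howard family `F` on `(Dt, β)` forming a coherent pair
(`ℋ_∞(F) ≤ Λκ_∞(C)`, `g • Λκ_∞(C) ≤ ℋ_∞(F)`, `g ≠ 0`) with `HasSpecWitnesses p 𝔖 𝒳 Λκ_∞(C)` AT THAT `C`: m-uniform control at
Howard's Eisenstein primes `q_m = T^m + p` (S1) and the error-free DVR Kolyvagin bound over `Λ/q_m` (S2), run on the port's OWN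
principal `p`-power system (no `∀ C` transfer). Why it might fail: S1's uniformity in `m` must absorb the `d(k)`-shift of the
stabilised classes (CGLS Thm. 4.1.1) in the control error terms, and S2 needs the specialised Kolyvagin system free of rank one
over the DVR `Λ/q_m` for all large `m` (Howard Thm. 1.6.1 with MZ26 Thm. 2.40 replacing surjectivity by scalars).
[cite: Howard2004HeegnerKolyvagin, Thm. 1.6.1, Lemma 2.2.8, Thm. 2.2.10] [cite: MastellaZerman2026, Thm. 2.40]
[cite: CastellaGrossiLeeSkinner2022, Thm. 4.1.1, Rem. 4.1.4] -/
theorem stub_specWitnessesCoherentPair : Summit.BirchSwinnertonDyer.BirchSwinnertonDyer.Theorems.HeegnerMuPartStabilized.SpecWitnessesCoherentPair := by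
  sorry

/-! ## §11 (v10) KERNEL CERTIFICATES BY NAME: stub ⟹ L∃ letter ⟹ crux; `∀ C` shell ⟹ stub (the stub is the WEAKER statement) -/

/-- **Tree L∃ shell ⟹ the crux stmt-27275 BY NAME (PROVED: p633080 `muPartStabilizedCoherentPair_of_specWitnessesCoherentPair`
∘ p631887 `howardContainmentLightFrameX10bPinnedOfPrint_of_muPartStabilizedCoherentPair`).** -/
theorem crux_of_specWitnessesCoherentPair (h : Summit.BirchSwinnertonDyer.BirchSwinnertonDyer.Theorems.HeegnerMuPartStabilized.SpecWitnessesCoherentPair) :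
    HowardContainmentLightFrameX10bPinnedOfPrint :=
  Summit.BirchSwinnertonDyer.BirchSwinnertonDyer.Theorems.PrintX10bSharpMuCoherentPair.howardContainmentLightFrameX10bPinnedOfPrint_of_muPartStabilizedCoherentPair
    (Summit.BirchSwinnertonDyer.BirchSwinnertonDyer.Theorems.HeegnerMuPartStabilized.muPartStabilizedCoherentPair_of_specWitnessesCoherentPair h)

/-- **Tree L∃ shell ⟹ the L∃ LETTER (the installed shared μ-item text) BY NAME (p633080).** -/
theorem muPartStabilizedCoherentPair_of_stub (h : Summit.BirchSwinnertonDyer.BirchSwinnertonDyer.Theorems.HeegnerMuPartStabilized.SpecWitnessesCoherentPair) :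
    Summit.BirchSwinnertonDyer.BirchSwinnertonDyer.Theorems.HeegnerMuPartStabilized.MuPartStabilizedCoherentPair :=
  Summit.BirchSwinnertonDyer.BirchSwinnertonDyer.Theorems.HeegnerMuPartStabilized.muPartStabilizedCoherentPair_of_specWitnessesCoherentPair h

/-- **Tree `∀ C` shell ⟹ tree L∃ shell (PROVED; the engine `exists_coherent_pair_envelope`)**: the stub is WEAKER than the
frame-free `∀ C` witness statement, by kernel. [cite: CastellaGrossiLeeSkinner2022, Rem. 4.1.4] [cite: Howard2004HeegnerKolyvagin, Thm. 3.3.7] -/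
theorem specWitnessesCoherentPair_of_specWitnessesFrameFree (h : Summit.BirchSwinnertonDyer.BirchSwinnertonDyer.Theorems.HeegnerMuPartStabilized.SpecWitnessesFrameFree) :
    Summit.BirchSwinnertonDyer.BirchSwinnertonDyer.Theorems.HeegnerMuPartStabilized.SpecWitnessesCoherentPair := by
  intro N _ W _ K _ _ p _ κ γ jbar hyp hCM hirr hirrK hsc hHp hhK hpN hTw1 hcardp Dt β hβ D X
  have hlev : N = W.conductorNorm ℤ := hyp.level
  subst hlev
  haveI : W.IsElliptic := hyp.isElliptic
  obtain ⟨C, F, hCDt, hFDt, hCβ, hFβ, hfwd, g, hg, hrev⟩ :=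
    exists_coherent_pair_envelope (W := W) hyp.isImaginaryQuadratic hyp.heegner Dt hβ jbar hyp.ordinary hpN
      κ hyp.topGenerator hTw1 hcardp hyp.noPTorsion D
  exact ⟨C, F, hCDt, hFDt, hCβ, hFβ, hfwd, ⟨g, hg, hrev⟩, fun hfinS hfinX htor ↦
    h _ W K p κ γ jbar hyp hCM hirr hirrK hsc hHp hhK D C X hfinS hfinX htor⟩

/-- **Tree `∀ C` shell ⟹ the crux (PROVED).** -/
theorem crux_of_specWitnessesFrameFreeTree (h : Summit.BirchSwinnertonDyer.BirchSwinnertonDyer.Theorems.HeegnerMuPartStabilized.SpecWitnessesFrameFree) :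
    HowardContainmentLightFrameX10bPinnedOfPrint :=
  crux_of_specWitnessesCoherentPair (specWitnessesCoherentPair_of_specWitnessesFrameFree h)

/-! ## §12 (v10) THE COMPOSED LINE from the ONE stub, BY NAME -/

/-- **THE COMPOSED LINE (v10)**: the crux BY NAME from the ONE stub `stub_specWitnessesCoherentPair` (the only sorry). -/
theorem HowardContainmentLightFrameX10bPinnedOfPrint_of_stubs : HowardContainmentLightFrameX10bPinnedOfPrint :=
  crux_of_specWitnessesCoherentPair stub_specWitnessesCoherentPair

/-- The LIGHT A₃ containment from the four print binders and the ONE stub (curried form). -/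
theorem howardContainmentLightFrameX10bPinned_of_print_of_stubs (hMZ : MastellaZermanHowardDivisibility)
    (hNV : CGLSHeegnerClassNonvanishing) (hCGS : CGSHowardDivisibilityPLocalized) (hTw : AnticyclotomicTowerSharp) :
    HowardContainmentLightFrameX10bPinned :=
  HowardContainmentLightFrameX10bPinnedOfPrint_of_stubs hMZ hNV hCGS hTw

/-! ## §13 (v9, kept in v10) THE EXACT RESIDUAL OF THE `∀ C` LETTER OVER L∃ / LP, IN μ-CURRENCY (typed; ONE-SIDED)

If the pen installs the `∀ C` letter after all, the honest skeleton is TWO stubs (trib-w g9 (b)): the road-native one above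
and a TRANSFER. In μ-currency the transfer is not the two-sided `ω_δ`-comparison `Λκ_∞(C) ~ Λκ_∞(C₀)` (REF-121 (4)) but the
ONE-SIDED domination `length_(p)(𝔖/Λκ_∞(C₀)) ≤ length_(p)(𝔖/Λκ_∞(C))` for every instance `C` on `(C₀.Dt, C₀.β)` — on paper:
`Λκ_∞(C) + Λκ_∞(C₀) ≤ 𝐇′` (all p-power-conductor Heegner norm classes; Shimura transitivity at conductor `p^j` — tree: conductor 1
only, `heegnerPointOfConductor_one_galoisConj`) and `μ(𝐇′/Λκ_∞(C₀)) = 0` (mod-p distribution relations). `Stmt.classModuleMuDominated`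
types it over the LP binders; `muInequality_transfer` is the (trivial) arithmetic of the transfer; torsion of `𝔖/Λκ_∞(C₀)`
comes at crux level from CGLS Thm. 4.1.1 (`hNV`) at `(D, C₀)`. NOT a stub of this file (the consensus letter is L∃). -/

/-- **Transfer residual (typed, NOT asserted, NOT a stub)**: μ-domination of the class module of an arbitrary stabilised
instance `C` by that of a principal-system instance `C₀` on the same `(Dt, β)`.
[cite: Howard2004HeegnerKolyvagin, §3.3, Thm. 3.3.7] [cite: PerrinRiou1987BSMF, §3.4 Prop. 10] [cite: CastellaGrossiLeeSkinner2022, Rem. 4.1.4] -/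
def Stmt.classModuleMuDominated : Prop :=
  ∀ (N : ℕ) [NeZero N] (W : WeierstrassCurve ℚ) [W.IsGloballyMinimal] (K : Type) [Field K] [NumberField K]
    (p : ℕ) [Fact p.Prime] (κ : ZpExtension K p) (γ : Field.absoluteGaloisGroup K)
    (jbar : AlgebraicClosure K →+* ℂ),
    CastellaGrossiLeeSkinner2022.Thm413Hypotheses N W K p κ γ →
    p ∣ NumberField.classNumber K →
    ∀ (D : (W.baseChange K).LambdaAdicSelmerData κ γ)
      (C C₀ : CastellaGrossiLeeSkinner2022.StabilizedHeegnerData N W K κ jbar)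
      (x : ℕ → WeierstrassCurve.geomPoints (W.baseChange K))
      (A : ℕ → Finset (Field.absoluteGaloisGroup K)),
    C.Dt = C₀.Dt → C.β = C₀.β →
    (∀ j, complexPoint W jbar (x j) =
      ModularForms.heegnerPointComplexOfConductor C₀.Dt (NumberField.discr K) C₀.β (p ^ j)) →
    (∀ j, ∀ σ ∈ ringClassSubgroup K (p ^ j) jbar, σ • x j = x j) →
    (∀ k, (∀ a ∈ A k, a ∈ κ.layerSubgroup k) ∧
      ∀ τ ∈ κ.layerSubgroup k, ∃! a, a ∈ A k ∧ a⁻¹ * τ ∈ ringClassSubgroup K (p ^ C₀.d k) jbar) →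
    (∀ k, C₀.u k = ∑ a ∈ A k, a • x (C₀.d k)) → (∀ k, C₀.v k = ∑ a ∈ A k, a • x (C₀.d k - 1)) →
    Module.Finite (IwasawaAlgebra p) D.S →
    Module.IsTorsion (IwasawaAlgebra p) (D.S ⧸ CastellaGrossiLeeSkinner2022.stabilizedHeegnerModule D C₀) →
    ∀ 𝔭 : PrimeSpectrum (IwasawaAlgebra p), 𝔭.asIdeal = Ideal.span {(p : IwasawaAlgebra p)} →
      Module.lengthAt (IwasawaAlgebra p) (D.S ⧸ CastellaGrossiLeeSkinner2022.stabilizedHeegnerModule D C₀) 𝔭 ≤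
        Module.lengthAt (IwasawaAlgebra p) (D.S ⧸ CastellaGrossiLeeSkinner2022.stabilizedHeegnerModule D C) 𝔭

/-- **The arithmetic of the transfer (PROVED, trivial)**: the inequality at `L₀` and μ-domination `L₀ ≼ L` give it at `L`. -/
theorem muInequality_transfer (p : ℕ) [Fact p.Prime] {S X : Type} [AddCommGroup S] [Module (IwasawaAlgebra p) S]
    [AddCommGroup X] [Module (IwasawaAlgebra p) X] (L L₀ : Submodule (IwasawaAlgebra p) S)
    (𝔭 : PrimeSpectrum (IwasawaAlgebra p))
    (h₀ : Module.lengthAt (IwasawaAlgebra p) (Submodule.torsion (IwasawaAlgebra p) X) 𝔭 ≤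
      2 * Module.lengthAt (IwasawaAlgebra p) (S ⧸ L₀) 𝔭)
    (hdom : Module.lengthAt (IwasawaAlgebra p) (S ⧸ L₀) 𝔭 ≤ Module.lengthAt (IwasawaAlgebra p) (S ⧸ L) 𝔭) :
    Module.lengthAt (IwasawaAlgebra p) (Submodule.torsion (IwasawaAlgebra p) X) 𝔭 ≤
      2 * Module.lengthAt (IwasawaAlgebra p) (S ⧸ L) 𝔭 :=
  h₀.trans (by gcongr)


/-! ## §14 (v11, decomp lens) THE QUANTIFIER OVER `m` IS ∃-INFINITE, NOT ∀-COFINITE: witnesses along ANY infinite set of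
levels `m` suffice

The μ-readout (`IwasawaAlgebra.lengthAt_le_two_mul_of_card_quotSMulTop_qm_le`, p625052) asks for the specialised inequality at
ALL large `m`; but `IwasawaAlgebra.exists_card_quotSMulTop_qm_bounds` gives TWO-SIDED asymptotics `#(N/q_m N) ≍ p^(m·μ(N))`, so the
inequality along ANY infinite set of `m` already forces `μ(𝒳_tors) ≤ 2·μ(𝔖/L)`. Hence the D1 constructor may choose its levels:
`HasSpecWitnessesAlong p S X L` (∃ c, for infinitely many m, a witness at `q_m` with constant `p^c`) replaces `HasSpecWitnesses`
(∃ c m₀, ∀ m ≥ m₀). Teeth: the specialisation `T ↦ π_m` (`π_m^m = -p`) twists the Galois action through `γ ↦ 1 + π_m`, and the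
m-uniform control (S1) / residual-irreducibility inputs are free to use a convenient residue class of `m` (e.g. `p^t ∣ m`, where
`(1+T)^(p^t) - 1 ∈ (p, T^(p^t))` makes the level-`t` twist `p`-adically small uniformly, §5) or to discard any finite or even
density-zero set of bad `m`. Everything below is PROVED; the weakened shell `Stmt.specWitnessesCoherentPairAlong` is a second
admissible TARGET for the D1 seat (it implies the installed letter and the crux BY NAME, and is implied by the stub). -/

/-- **Exponent comparison along a subsequence.** If `1 < p` and `p^(m·u) ≤ D · p^(m·v)` for infinitely many `m`, then
`u ≤ v`. [cite: Howard2004HeegnerKolyvagin, Thm. 2.2.10 (proof: 𝔮 = (T^m + p), m → ∞)] -/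
theorem le_of_frequently_pow_mul_le {p : ℕ} (hp : 1 < p) {u v D : ℕ}
    (h : ∀ M : ℕ, ∃ m, M ≤ m ∧ p ^ (m * u) ≤ D * p ^ (m * v)) : u ≤ v := by
  by_contra huv
  push Not at huv
  obtain ⟨m, hDm, hm⟩ := h D
  have hpm : p ^ (m * v) * p ^ m ≤ p ^ (m * u) := by
    rw [← pow_add]
    exact Nat.pow_le_pow_right (by omega) (by nlinarith)
  have hle : p ^ (m * v) * p ^ m ≤ p ^ (m * v) * D := by
    calc p ^ (m * v) * p ^ m ≤ p ^ (m * u) := hpm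
      _ ≤ D * p ^ (m * v) := hm
      _ = p ^ (m * v) * D := by ring
  have hD : p ^ m ≤ D := Nat.le_of_mul_le_mul_left hle (by positivity)
  have hlt : D < p ^ m := lt_of_le_of_lt hDm (Nat.lt_pow_self hp)
  omega

/-- **μ-transfer along a subsequence (μ-invariant currency).** For f.g. torsion `Λ`-modules `N`, `N'`: if
`#(N/q_m N) ≤ p^C · #(N'/q_m N')²` for INFINITELY MANY `m`, then `μ(N) ≤ 2 μ(N')` (two-sided asymptotics of both counts).
[cite: Howard2004HeegnerKolyvagin, proof of Thm. 2.2.10] [cite: Washington1997, §13.2] -/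
theorem muInvariant_le_two_mul_of_frequently_card_le (p : ℕ) [Fact p.Prime] (N N' : Type*) [AddCommGroup N]
    [Module (IwasawaAlgebra p) N] [AddCommGroup N'] [Module (IwasawaAlgebra p) N']
    [Module.Finite (IwasawaAlgebra p) N] [Module.Finite (IwasawaAlgebra p) N']
    (hN : Module.IsTorsion (IwasawaAlgebra p) N) (hN' : Module.IsTorsion (IwasawaAlgebra p) N')
    (h : ∃ C : ℕ, ∀ M : ℕ, ∃ m : ℕ, M ≤ m ∧
      Nat.card (N ⧸ (Ideal.span {(PowerSeries.X ^ m + PowerSeries.C (p : ℤ_[p]) : IwasawaAlgebra p)} • ⊤ :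
        Submodule (IwasawaAlgebra p) N)) ≤
      p ^ C * Nat.card (N' ⧸ (Ideal.span {(PowerSeries.X ^ m + PowerSeries.C (p : ℤ_[p]) :
        IwasawaAlgebra p)} • ⊤ : Submodule (IwasawaAlgebra p) N')) ^ 2) :
    muInvariant p N ≤ 2 * muInvariant p N' := by
  have hp : p.Prime := Fact.out
  obtain ⟨C, hC⟩ := h
  obtain ⟨B, m₁, -, h1⟩ := IwasawaAlgebra.exists_card_quotSMulTop_qm_bounds p N hN
  obtain ⟨B', m₂, -, h2⟩ := IwasawaAlgebra.exists_card_quotSMulTop_qm_bounds p N' hN'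
  refine le_of_frequently_pow_mul_le hp.one_lt (D := B * p ^ C * B' ^ 2) fun M => ?_
  obtain ⟨m, hm, hcm⟩ := hC (max M (max m₁ m₂))
  have hM : M ≤ m := le_trans (le_max_left _ _) hm
  have hm1 : m₁ ≤ m := le_trans (le_trans (le_max_left _ _) (le_max_right _ _)) hm
  have hm2 : m₂ ≤ m := le_trans (le_trans (le_max_right _ _) (le_max_right _ _)) hm
  obtain ⟨-, hlow, -⟩ := h1 m hm1
  obtain ⟨-, -, hup⟩ := h2 m hm2
  refine ⟨m, hM, ?_⟩
  calc p ^ (m * muInvariant p N) ≤ B * Nat.card (N ⧸ _) := hlow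
    _ ≤ B * (p ^ C * Nat.card (N' ⧸ _) ^ 2) := Nat.mul_le_mul_left _ hcm
    _ ≤ B * (p ^ C * (B' * p ^ (m * muInvariant p N')) ^ 2) := by gcongr
    _ = B * p ^ C * B' ^ 2 * p ^ (m * (2 * muInvariant p N')) := by ring

/-- **μ-transfer along a subsequence, local-length currency** (the hypothesis shape of the promotion lemmas).
[cite: Howard2004HeegnerKolyvagin, proof of Thm. 2.2.10] [cite: Washington1997, §13.2] -/
theorem lengthAt_le_two_mul_of_frequently_card_le (p : ℕ) [Fact p.Prime] (N N' : Type*) [AddCommGroup N]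
    [Module (IwasawaAlgebra p) N] [AddCommGroup N'] [Module (IwasawaAlgebra p) N']
    [Module.Finite (IwasawaAlgebra p) N] [Module.Finite (IwasawaAlgebra p) N']
    (hN : Module.IsTorsion (IwasawaAlgebra p) N) (hN' : Module.IsTorsion (IwasawaAlgebra p) N')
    (h : ∃ C : ℕ, ∀ M : ℕ, ∃ m : ℕ, M ≤ m ∧
      Nat.card (N ⧸ (Ideal.span {(PowerSeries.X ^ m + PowerSeries.C (p : ℤ_[p]) : IwasawaAlgebra p)} • ⊤ :
        Submodule (IwasawaAlgebra p) N)) ≤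
      p ^ C * Nat.card (N' ⧸ (Ideal.span {(PowerSeries.X ^ m + PowerSeries.C (p : ℤ_[p]) :
        IwasawaAlgebra p)} • ⊤ : Submodule (IwasawaAlgebra p) N')) ^ 2)
    (𝔭 : PrimeSpectrum (IwasawaAlgebra p)) (h𝔭 : 𝔭.asIdeal = Ideal.span {(p : IwasawaAlgebra p)}) :
    Module.lengthAt (IwasawaAlgebra p) N 𝔭 ≤ 2 * Module.lengthAt (IwasawaAlgebra p) N' 𝔭 := by
  have h1 := muInvariant_le_two_mul_of_frequently_card_le p N N' hN hN' h
  have h𝔭' : 𝔭.asIdeal = IwasawaAlgebra.augIdealP p := by rw [h𝔭, IwasawaAlgebra.span_natCast_eq_augIdealP]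
  have hN1 := Literature.NumberTheory.EllipticCurves.lengthAt_ne_top_of_isTorsion p N hN 𝔭 h𝔭'
  have hN2 := Literature.NumberTheory.EllipticCurves.lengthAt_ne_top_of_isTorsion p N' hN' 𝔭 h𝔭'
  rw [Literature.NumberTheory.EllipticCurves.muInvariant_eq_toNat_lengthAt p N 𝔭 h𝔭',
    Literature.NumberTheory.EllipticCurves.muInvariant_eq_toNat_lengthAt p N' 𝔭 h𝔭'] at h1
  rw [← ENat.coe_toNat hN1, ← ENat.coe_toNat hN2]
  exact_mod_cast h1

/-- **Pointwise witness predicate ALONG A SUBSEQUENCE**: `∃ c`, for infinitely many `m`, a (tree) `SpecWitness` at `q_m` with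
constant `p^c`. Weaker than the tree's `HasSpecWitnesses` (all large `m`). [cite: Howard2004HeegnerKolyvagin, proof of Thm. 2.2.10] -/
def HasSpecWitnessesAlong (p : ℕ) [Fact p.Prime] (S X : Type) [AddCommGroup S] [Module (IwasawaAlgebra p) S]
    [AddCommGroup X] [Module (IwasawaAlgebra p) X] (L : Submodule (IwasawaAlgebra p) S) : Prop :=
  ∃ c : ℕ, ∀ M : ℕ, ∃ m : ℕ, M ≤ m ∧
    Nonempty (Summit.BirchSwinnertonDyer.BirchSwinnertonDyer.Theorems.HeegnerMuPartStabilized.SpecWitness (IwasawaAlgebra p) S X L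
      (PowerSeries.X ^ m + PowerSeries.C (p : ℤ_[p]) : IwasawaAlgebra p) (p ^ c))

/-- `HasSpecWitnesses` (all large `m`) ⟹ `HasSpecWitnessesAlong` (infinitely many `m`). [folklore] -/
theorem hasSpecWitnessesAlong_of_hasSpecWitnesses (p : ℕ) [Fact p.Prime] {S X : Type} [AddCommGroup S]
    [Module (IwasawaAlgebra p) S] [AddCommGroup X] [Module (IwasawaAlgebra p) X] {L : Submodule (IwasawaAlgebra p) S}
    (h : Summit.BirchSwinnertonDyer.BirchSwinnertonDyer.Theorems.HeegnerMuPartStabilized.HasSpecWitnesses p S X L) : HasSpecWitnessesAlong p S X L := by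
  obtain ⟨c, m₀, hw⟩ := h
  exact ⟨c, fun M => ⟨max M m₀, le_max_left _ _, hw _ (le_max_right _ _)⟩⟩

/-- **THE POINTWISE THEOREM ALONG A SUBSEQUENCE**: `HasSpecWitnessesAlong` ⟹ the μ-inequality at `(p)` (tree
`card_quot_torsion_le_of_specWitness` at each good `m` + the subsequence μ-transfer above).
[cite: Howard2004HeegnerKolyvagin, proof of Thm. 2.2.10 (𝔮 = T^m + p)] [cite: Washington1997, §13.2] -/
theorem lengthAt_torsion_le_two_mul_of_hasSpecWitnessesAlong (p : ℕ) [Fact p.Prime] {S X : Type}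
    [AddCommGroup S] [Module (IwasawaAlgebra p) S] [AddCommGroup X] [Module (IwasawaAlgebra p) X]
    [Module.Finite (IwasawaAlgebra p) S] [Module.Finite (IwasawaAlgebra p) X]
    (L : Submodule (IwasawaAlgebra p) S) (hL : Module.IsTorsion (IwasawaAlgebra p) (S ⧸ L))
    (hW : HasSpecWitnessesAlong p S X L)
    (𝔭 : PrimeSpectrum (IwasawaAlgebra p)) (h𝔭 : 𝔭.asIdeal = Ideal.span {(p : IwasawaAlgebra p)}) :
    Module.lengthAt (IwasawaAlgebra p) (Submodule.torsion (IwasawaAlgebra p) X) 𝔭 ≤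
      2 * Module.lengthAt (IwasawaAlgebra p) (S ⧸ L) 𝔭 := by
  haveI : IsNoetherian (IwasawaAlgebra p) X := isNoetherian_of_isNoetherianRing_of_finite _ _
  haveI : Module.Finite (IwasawaAlgebra p) (Submodule.torsion (IwasawaAlgebra p) X) := inferInstance
  haveI : Module.Finite (IwasawaAlgebra p) (S ⧸ L) := inferInstance
  have htor := Submodule.torsion_isTorsion (R := IwasawaAlgebra p) (M := X)
  refine lengthAt_le_two_mul_of_frequently_card_le p _ _ htor hL ?_ 𝔭 h𝔭
  obtain ⟨c, hw⟩ := hW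
  obtain ⟨B, m₁, -, h1⟩ := IwasawaAlgebra.exists_card_quotSMulTop_qm_bounds p _ htor
  obtain ⟨B', m₂, -, h2⟩ := IwasawaAlgebra.exists_card_quotSMulTop_qm_bounds p _ hL
  refine ⟨3 * c, fun M => ?_⟩
  obtain ⟨m, hm, ⟨w⟩⟩ := hw (max M (max m₁ m₂))
  haveI := (h1 m (le_trans (le_trans (le_max_left _ _) (le_max_right _ _)) hm)).1
  haveI := (h2 m (le_trans (le_trans (le_max_right _ _) (le_max_right _ _)) hm)).1
  refine ⟨m, le_trans (le_max_left _ _) hm, ?_⟩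
  calc _ ≤ _ := Summit.BirchSwinnertonDyer.BirchSwinnertonDyer.Theorems.HeegnerMuPartStabilized.card_quot_torsion_le_of_specWitness (IwasawaAlgebra.X_pow_add_C_ne_zero p m) w
    _ = _ := by rw [← pow_mul, mul_comm c 3]

/-- **L∃ SHELL ALONG A SUBSEQUENCE** — the second admissible D1 target: the tree L∃ shell `SpecWitnessesCoherentPair` with
`HasSpecWitnesses` replaced by `HasSpecWitnessesAlong` (witnesses at infinitely many `q_m` only).
[cite: Howard2004HeegnerKolyvagin, Thm. 2.2.10] [cite: MastellaZerman2026, Thm. 2.40] [cite: CastellaGrossiLeeSkinner2022, Rem. 4.1.4] -/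
def Stmt.specWitnessesCoherentPairAlong : Prop :=
  ∀ (N : ℕ) [NeZero N] (W : WeierstrassCurve ℚ) [W.IsGloballyMinimal] (K : Type) [Field K] [NumberField K]
    (p : ℕ) [Fact p.Prime] (κ : ZpExtension K p) (γ : Field.absoluteGaloisGroup K)
    (jbar : AlgebraicClosure K →+* ℂ),
    CastellaGrossiLeeSkinner2022.Thm413Hypotheses N W K p κ γ →
    ¬ W.HasCM → W.HasIrreducibleModPGaloisRep p → (W.baseChange K).HasIrreducibleModPGaloisRep p →
    MastellaZerman2026.HasPadicScalarImage W p → SatisfiesHeegnerHypothesis p K →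
    p ∣ NumberField.classNumber K →
    ¬ p ∣ N →
    (∀ k, ringClassSubgroup K (p ^ (k + 1)) jbar ≤ κ.layerSubgroup k) →
    Nat.card (ringClassGalOver (jbar.comp (algebraMap K (AlgebraicClosure K))) p 1) = p - 1 →
    ∀ (Dt : ModularForms.ModularParametrizationData W N) (β : ℤ), (4 * N : ℤ) ∣ β ^ 2 - NumberField.discr K →
    ∀ (D : (W.baseChange K).LambdaAdicSelmerData κ γ) (X : (W.baseChange K).SelmerDualData κ γ),
    ∃ (C : CastellaGrossiLeeSkinner2022.StabilizedHeegnerData N W K κ jbar) (F : HeegnerFamily N W K κ jbar),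
      C.Dt = Dt ∧ F.Dt = Dt ∧ C.β = β ∧ F.β = β ∧
      heegnerModule D F ≤ CastellaGrossiLeeSkinner2022.stabilizedHeegnerModule D C ∧
      (∃ g : IwasawaAlgebra p, g ≠ 0 ∧
        g • CastellaGrossiLeeSkinner2022.stabilizedHeegnerModule D C ≤ heegnerModule D F) ∧
      (Module.Finite (IwasawaAlgebra p) D.S → Module.Finite (IwasawaAlgebra p) X.X →
        Module.IsTorsion (IwasawaAlgebra p)
          (D.S ⧸ CastellaGrossiLeeSkinner2022.stabilizedHeegnerModule D C) →
        HasSpecWitnessesAlong p D.S X.X (CastellaGrossiLeeSkinner2022.stabilizedHeegnerModule D C))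

/-- The stub (tree L∃ shell) ⟹ the subsequence shell (PROVED: weaker target). [folklore] -/
theorem specWitnessesCoherentPairAlong_of_stub (h : Summit.BirchSwinnertonDyer.BirchSwinnertonDyer.Theorems.HeegnerMuPartStabilized.SpecWitnessesCoherentPair) :
    Stmt.specWitnessesCoherentPairAlong := by
  intro N _ W _ K _ _ p _ κ γ jbar hyp hcm hirr hirrK hsc hHp hhK hpN hTw1 hcardp Dt β hβ D X
  obtain ⟨C, F, hCDt, hFDt, hCβ, hFβ, hfwd, hrev, hWit⟩ :=
    h N W K p κ γ jbar hyp hcm hirr hirrK hsc hHp hhK hpN hTw1 hcardp Dt β hβ D X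
  exact ⟨C, F, hCDt, hFDt, hCβ, hFβ, hfwd, hrev, fun hfinS hfinX htorC =>
    hasSpecWitnessesAlong_of_hasSpecWitnesses p (hWit hfinS hfinX htorC)⟩

/-- **Subsequence shell ⟹ the installed L∃ LETTER `MuPartStabilizedCoherentPair` BY NAME (PROVED).**
[cite: Howard2004HeegnerKolyvagin, proof of Thm. 2.2.10] [cite: MastellaZerman2026, Thm. 2.40] -/
theorem muPartStabilizedCoherentPair_of_specWitnessesCoherentPairAlong (h : Stmt.specWitnessesCoherentPairAlong) :
    Summit.BirchSwinnertonDyer.BirchSwinnertonDyer.Theorems.HeegnerMuPartStabilized.MuPartStabilizedCoherentPair := by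
  intro N _ W _ K _ _ p _ κ γ jbar hyp hcm hirr hirrK hsc hHp hhK hpN hTw1 hcardp Dt β hβ D X
  obtain ⟨C, F, hCDt, hFDt, hCβ, hFβ, hfwd, hrev, hWit⟩ :=
    h N W K p κ γ jbar hyp hcm hirr hirrK hsc hHp hhK hpN hTw1 hcardp Dt β hβ D X
  refine ⟨C, F, hCDt, hFDt, hCβ, hFβ, hfwd, hrev, fun hfinS hfinX htorC 𝔭 h𝔭 => ?_⟩
  haveI := hfinS
  haveI := hfinX
  exact lengthAt_torsion_le_two_mul_of_hasSpecWitnessesAlong p _ htorC (hWit hfinS hfinX htorC) 𝔭 h𝔭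

/-- **Subsequence shell ⟹ the crux stmt-27275 BY NAME (PROVED; via p631887).** -/
theorem crux_of_specWitnessesCoherentPairAlong (h : Stmt.specWitnessesCoherentPairAlong) :
    HowardContainmentLightFrameX10bPinnedOfPrint :=
  Summit.BirchSwinnertonDyer.BirchSwinnertonDyer.Theorems.PrintX10bSharpMuCoherentPair.howardContainmentLightFrameX10bPinnedOfPrint_of_muPartStabilizedCoherentPair
    (muPartStabilizedCoherentPair_of_specWitnessesCoherentPairAlong h)

end Summit.BirchSwinnertonDyer.BirchSwinnertonDyer.Cruxes.HowardContainmentLightFrameX10bPinnedOfPrint.SpecialiseFirstMu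

end
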